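import Summits.AtomisticToContinuum.Crystallization.Theorems.CoarseGrains.Negative.PredicateAPI
import Summits.AtomisticToContinuum.Crystallization.Theorems.CoarseGrains.Negative.LoadBearing
import Summits.AtomisticToContinuum.Crystallization.Theorems.CoarseGrains.Negative.CubicThreshold
import Summits.AtomisticToContinuum.Crystallization.Theorems.CoarseGrains.Negative.VacuityThreshold
import Summits.AtomisticToContinuum.Crystallization.Theorems.HcpLiouville.Negative.EquilLoadBearing

/-!
# Disproof of `FineGrains` (crux stmt-AtomisticToContinuum-9330, route ExcessDecayLiouville) — findings

Standing adversary file of seat `refuter-cdisprove-stmt-AtomisticToContinuum-9330-0` (cycle 1,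
2026-08-16).  VERDICT SO FAR: **no kill** — the crux (the route's ex-target, auto-cruxed at rev 3) is
crystallization-strength and resists every cheap attack; what IS settled (sorry-free, standard axioms)
is proved below and is being landed under `Theorems/FineGrains/Negative/` (`LoadBearing`,
`RadiusVacuity`, `FccObstruction`, `HcpModel`, `HcpModelRelaxed`; see HANDOFF).  This file imports — does not duplicate —
the sibling seats' landed kits for `CoarseGrains` (stmt-9331) and `HcpLiouville` (stmt-9332,
`EquilLoadBearing.hcpLiouvilleSites_eq_hcpStacking`): `Theorems/CoarseGrains/Negative/PredicateAPI` (`Lam`/`Near`/`Adm`/`Inner`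
VERBATIM the crux's `let`s; Delone kit `exists_site_near`, `le_dist_site_of_ne`, `adm_le_norm`, …),
`LoadBearing` (`isGroundState_fin_zero`), `CubicThreshold` (`cube_le_card_of_near`), `VacuityThreshold`
(`int_quad_nonneg₁`).

## The crux, read back (elaborates; `fineGrains_iff` is `Iff.rfl`)

`FineGrains ↔ ∀ ρ ε > 0, ∃ N₀, ∀ N ≥ N₀, ∀ x : Fin N → ℝ³, IsGroundState V_LJ x → HasFineBall ρ ε x`,
`HasFineBall ρ ε x := ∃ c t A, Adm A ∧ Near (range x) c ρ t A ε` with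
* `Λ = ℤu + ℤv + ℤ·2√(2/3)e₃` (`u = (1,0,0)`, `v = (1/2,√3/2,0)`; period lattice of the unit hcp
  stacking, `BarlowStacking` ll. 213–225 ✓);
* `Near X c ρ t A ε`: (i) every `p ∈ X` with `dist p c ≤ ρ` is within `ε` of SOME site `t m + A z`
  (`m : Fin 2`, `z ∈ Λ`, the site need not lie in the ball); (ii) every site in the closed ball has a
  particle within `ε`.  Closed balls; `c` is arbitrary (not a particle); matching is not injective.
* `Adm A`: `‖A − 0.97·O‖_op ≤ 1/40` for a linear isometry `O` (reflections allowed) ⇒ singular values in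
  `[0.945, 0.995]`, `A` invertible (`adm_injective/surjective`).  NOTE: the isometric cell `A = O` is NOT
  admissible (`‖O − 0.97O‖ = 0.03 > 1/40`): matched bonds are `≤ 0.995 + 2ε` — consistent with the
  relaxed LJ spacing `a* = (A₁₂/A₆)^{1/6} = 0.9712` (margin `0.024`), not with unit bonds.
* `t : Fin 2 → ℝ³` is FREE — no `Inner` clause (unlike `CoarseGrains`): the two sublattices may even
  COLLAPSE (`t 0 = t 1`, site set a simple-hexagonal Bravais lattice) or sit at any mutual offset; this
  only weakens the claim (an hcp grain is two-way matched only by hcp-class offsets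
  `±A(w + √(2/3)e₃) + AΛ`; fcc is matched by NO offset class — PROVED for `ε ≤ 1/100`, `ρ ≥ 3` in
  §(g); other non-hcp Barlow stackings presumably likewise — the POLYTYPE candidate of the HANDOFF).
* `IsGroundState` = injective ∧ energy `= E(N)` (infimum over injective configurations; genuine since
  `V_LJ ≥ −1/12`); ground states exist for every `N` (`LennardJonesGroundStatesExist_holds`) and are
  `δ`-separated, so `∀ x` is neither vacuous nor junk-fed (`V_LJ(0) = 0` junk never enters).
No junk operator (`dist`, operator norm, `Real.sqrt` of positive literals).  Quantifier order matches
the informal text: `N₀ = N₀(ρ, ε)`; the datum `(c, t, A)` depends on the ground state AND on `ε`.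

## (a) Load-bearing hypotheses — any proof must use BOTH minimality and largeness
* `exists_bond_of_near`: a matched ball of radius `≥ 21/10` at tolerance `ε < 189/400` forces two
  distinct particles at distance in `[189/200 − 2ε, 199/200 + 2ε]` (two adjacent sites of sublattice 0
  lie in the ball); hence `fineGrains_forces_bonds` — the crux implies that all large ground states have
  a BOND NEAR THE WINDOW `[0.945, 0.995]` (cheapest necessary condition; relaxed bulk bonds `≈ 0.971`).
* `fineGrains_false_without_minimality`: for arbitrary injective configurations it fails at
  `(ρ, ε) = (3, 1/40)` — the collinear gas (`not_near_gas`: its particles are `≥ 10` apart).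
* `fineGrains_false_without_largeness`: without `N ≥ N₀` it fails at `ρ = 2` and EVERY `ε` (the empty
  ground state owns no site; `not_hasFineBall_fin_zero` from `ρ ≥ 11/10`).
* (a′) size of `N₀(ρ, ε)`: `one_le_threshold` (`ρ ≥ 11/10 ⇒ N₀ ≥ 1`, any `ε`), `threshold_cubic`
  (`ε ≤ 1/40`, `ρ ≥ 11/10 + 4K ⇒ N₀ ≥ (K+1)³`).  The honest count of sites in a matched ball is
  `≈ 6.5ρ³`; physically `N₀` is astronomically larger ("WHY", 4).
* `0 < ρ` is decoration (`fineGrains_iff_forall_radius`); `0 < ε` is needed only to exclude `ε < 0`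
  (`not_hasFineBall_of_neg`) — `ε = 0` is the "exact grains" strengthening of (c).

## (b) Vacuity thresholds — the contentful region is `ρ ≥ 199/200`, `ε < max(ρ, 11/10)`
* `near_trivial_collapsed` / `hasFineBall_of_lt`: for `ρ < 199/200` the matrix holds for EVERY bounded
  set at EVERY real `ε` (collapsed datum `t 0 = t 1`, `A = (199/200)·id` admissible with equality, ball
  centred at the deep hole `w + √(2/3)e₃` of `Λ`, which is `≥ 1` from `Λ`:
  `one_le_norm_sq_lam_sub_hole`, `‖z − hole‖² = (i²+ij+j²−i−j+1/3) + (2/3)(2k−1)²`).  This is sharper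
  than the sibling's `7/10` for `CoarseGrains` precisely because `Inner` is absent; the exact threshold
  `199/200` is EXACT: `exists_lam_near_one` (sharp covering radius `1` of `Λ`, via the in-plane
  circumradius bound `exists_int_tri_near`) and `exists_site_near_sharp` (`199/200` for admissible site
  sets, improving the kit's `11/10`) give `not_near_empty_of_le`: from `ρ ≥ 199/200` the empty
  configuration fails (`N₀ ≥ 1`).  Provers may take `N₀ := 0` below it.
* `hasFineBall_of_large_tol`: for `ε ≥ max(ρ, 11/10)` and `N ≥ 1` the matrix holds for every
  configuration (ball centred at a particle, datum `0.97·id`, `adm_smul_id`).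

## (f) Normalisation (infrastructure): `near_translate`, `near_swap`, `near_normalise` — a matched datum
may be replaced by one with the same cell and both sublattice origins within `11/10` of the ball's
centre (what the compactness steps of GrainsGlue / LimitGlue need; landed with `LoadBearing`).

## (g) The fcc obstruction — the route's kill criterion, kernel-checked (landed as `FccObstruction`)
* `fcc_dist_sq_dichotomy`: squared distances in `fccStacking a h` (`a ∈ [0.96,0.99]`, `h ∈ [0.78,0.81]`)
  are `≤ 1.99` or `≥ 2.74`; `not_near_of_locally_fcc` / `not_near_of_subset_fcc`: NO admissible datum —
  whatever the free offsets `t` — two-way `ε`-matches, on a ball of radius `ρ ≥ 3` at `ε ≤ 1/100`, a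
  set whose part in the ball lies in an isometric image of such an fcc stacking (the c-period site pair
  `s, s + A·2√(2/3)e₃` owns two fcc points at distance within `2ε` of `‖A·2√(2/3)e₃‖ ∈ [1.543, 1.625]`,
  squared in `(1.99, 2.74)`); `fineGrains_matrix_fails_on_fcc`; and the conditional kill
  `fineGrains_false_of_fccPieces : FccPieceGroundStates → ¬FineGrains` (workfile only; the hypothesis
  is believed FALSE and is NOT filed as a construction); `not_near_of_locally_fcc_coarse`: the same
  obstruction at the COARSE tolerance `1/40` for fcc cells within `±0.4 %` of the relaxed one — so the
  sibling crux `CoarseGrains` (with or without `Inner`) also fails on near-relaxed fcc pieces.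

## (h) The intended model (landed as `HcpModel`): `near_hcpStacking` / `near_of_locally_hcp` /
`fineGrains_matrix_of_locally_hcp` — hcp pieces (`a ∈ [0.945, 0.995]`, ideal `c/a`) HAVE fine balls at
every `ε ≥ 0`; with (g) the matrix discriminates hcp from fcc exactly as the crux intends (no junk model,
no wrong-reason truth or falsity found).

## (h′) (landed as `HcpModelRelaxed`): `adm_cell`, `sites_cell_eq`, `near_relaxedHcpStacking`,
`fineGrains_matrix_of_locally_relaxedHcp` — the same for the RELAXED hcp crystal `hcpStacking a h` with
`h = (a + δ)√(2/3)`, `|a − 0.97| + |δ| ≤ 1/40` (axially stretched cell `a·id + δ·P₃`): the window absorbs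
the relaxed `c/a`.

## (c) Natural strengthenings
* REFUTED: `not_fineGrains_uniform_radius` (`∃ N₀ ∀ ρ ε` — a ground state of `N₀` particles cannot fill
  a ball of radius `11/10 + 4N₀`).
* NOT refutable here, believed FALSE (recorded to save the next seat the time): (1) `N₀` uniform in `ε`
  for fixed `ρ` (`∀ ρ ∃ N₀ ∀ ε`): by compactness of normalised data (`A` in a compact set, `t` mod `AΛ`,
  `c` within `ρ + ε` of a particle once `ρ ≥ 11/10`; `near_normalise`) it implies EXACT affine-hcp
  balls (`ε = 0`) of every radius `ρ' < ρ` in every large ground state; finite clusters carry inhomogeneous surface-stress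
  strain `~ρ²/L²`, so exact balls presumably never occur — but no theorem pins the positions of any LJ
  ground state with `N ≥ 5`.  (For `N = 2,3,4` — unit simplices — `HasFineBall ρ 0 x` fails for
  `ρ ≥ 21/10` since two same-sublattice sites in the ball are `‖Au‖ ∈ [0.945, 0.995] ≠ 1` apart; that
  only says `N₀ ≥ 5` there.)  (2) an `N₀` polynomial in `ρ, 1/ε` ("WHY", 4).  (3) a datum common to all
  balls of one ground state / `c` at every interior particle (global statements are the stronger
  siblings BulkDefectVanish stmt-0751, PeriodicWindows stmt-3240).
* WEAKER NEIGHBOURS, for orientation (c′): `FineGrains → CoarseGrainsWithoutInner` (`ε := 1/40`) and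
  `CoarseGrains → CoarseGrainsWithoutInner`; `FineGrains → CoarseGrains` is NOT pure logic (a fine datum
  of a non-hcp offset class matching some ground state is excluded only by ground-state structure); the
  route uses `GrainsGlue : PhononStability → HcpLiouville → CoarseGrains → FineGrains` instead.

## (d) Targets — none (payload `targets = []`, `stuck_stubs = []`; no line picked for this crux yet).
## (e) Near-misses — none (nothing sorried: no candidate kill is believed true by this seat).

## WHY THE CRUX RESISTS (for ideators / planners / the lead)
`¬FineGrains ⟺ ∃ ρ ε > 0: for infinitely many N some LJ ground state has NO two-way ε-matched admissible
affine-hcp ball of radius ρ` (`not_fineGrains_iff`).  Exhibiting this needs STRUCTURAL knowledge of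
large Lennard-Jones ground states in `ℝ³` for infinitely many `N` — the crystallization problem itself
(BlancLewin2015 §2.3, "completely open in dimension three").  The rigorous facts in hand (existence,
`δ`-separation, `E(N) ≥ −CN`, neighbour counting, small-`N` simplices, the `N = 13` icosahedral
comparison of `Literature.Barriers.AtomisticToContinuum.IcosahedralClusters`) constrain nothing at scale
`ρ` for large `N`.  Kill routes tried and why each dies:
1. *fcc / polytype bulk* (the item's own `why it might fail`; van de Waal 1991
   doi:10.1103/physrevlett.67.3263 — rare-gas solids grow fcc).  PROVED here (§(g),
   `not_near_of_subset_fcc`): a piece of a relaxed fcc stacking (cell box `[0.96,0.99]×[0.78,0.81]`) of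
   ANY size has no fine ball of radius `≥ 3` at `ε ≤ 1/100`, whatever the free offset `t 1 − t 0` (the
   c-period site pair forces an fcc distance within `2ε` of `[1.543, 1.625]`, but relaxed-fcc squared
   distances avoid `(1.99, 2.74)`; at the single tolerance `1/40` of `CoarseGrains[WithoutInner]` the
   same argument works for cells within `±0.4 %` of the relaxed one, `not_near_of_locally_fcc_coarse`,
   margins `≈ 3·10⁻³`), so FineGrains IS false if for infinitely many
   `N` some ground state is fcc-grained at scale 3 (`fineGrains_false_of_fccPieces` for whole fcc pieces) —
   but for `V = r⁻¹²/12 − r⁻⁶/6` the static lattice sums give `e_hcp = −0.717590 < e_fcc = −0.717518`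
   (Kihara–Koba / Stillinger2001 `A₆, A₁₂`; gap `7.25·10⁻⁵`/particle), the sibling seat's relaxed scan
   (job j010494; all 61 h/c necklaces of Zhdanov period `≤ 8`, re-relaxed in `(a, h)`) puts EVERY other
   Barlow stacking above hcp by `7.20–7.25·10⁻⁵` per c-layer atom (Hägg domination, tree items
   0716/0737), and zero-point / thermal effects that favour fcc in real argon are absent at `T = 0`,
   classical.  So print points TOWARDS hcp asymptotically; nothing is proved either way.
2. *amorphous / icosahedral / decahedral bulk* (barriers IcosahedralClusters, TetrahedralFrustration):
   finite-`N` numerics (Mackay icosahedra to `N ~ 10³`, Marks decahedra to `~10⁵`, then fcc/hcp with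
   faults; PartayOrtnerCsanyi2017, Doye–Calvo 2002) concern the crossover, the crux is asymptotic; no
   theorem-level handle exists in either direction.
3. *strain*: uniform strain, the non-ideal `c/a` (relaxed hcp `(a, h) = (0.971274, 0.792930)`, i.e.
   principal stretches `(0.9713, 0.9713, 0.9711)`, `‖A* − 0.97·id‖ = 0.0013 ≪ 1/40`) and the Laplace
   compression `~1/L` are absorbed by the affine window; inhomogeneous surface-stress strain gives
   displacement `~ρ²/L²` off the best affine fit on `B_ρ`, absorbed by `N₀(ρ, ε) ≳ (ρ²/ε)^{3/2}`; the free
   inner displacement absorbs sublattice relaxation (symmetry-fixed in the bulk anyway, Wyckoff 2c).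
4. *how large `N₀` must be*: bulk preference `7.25·10⁻⁵`/particle against `O(1)·N^{2/3}` facet /
   twin-boundary energetics ⇒ exact ground states may stay icosahedral/decahedral/fcc-twinned up to
   `N ~ 10⁹–10¹²`; hence NO finite computation can confirm or refute the crux (both sides blocked by
   the same wall), and only soft (`N → ∞`, compactness) proofs can work — which is the route's plan.
5. *degenerate parameters*: `ρ → 0` and `ε → ∞` are vacuous (b, b′); `N` small is excluded by `N₀`
   (a′); `ε < 0` is excluded by `0 < ε`; `ε → 0` with `ρ` fixed is the honest regime (c, 1).
6. *density / counting*: two-way matching forces `≈ 6.5|det A|⁻¹ρ³·(1 or 2 sublattice classes)` particles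
   in the ball, i.e. local density in `[0.72, 1.68]`; the only rigorous density information on LJ
   ground states (`δ`-separation ⇒ density `≤ 2.8`; no lower bound at scale, cf. NoFoam stmt-2912) is
   compatible — no counting contradiction.
7. *negatives index* (`ledger negatives`, 12 entries; Crystallization: 3506 piling-on-one-site — excluded
   here: ground states are injective and same-sublattice sites are `≥ 189/200` apart; 4146 decahedral
   soft shell — about contact-graph rigidity, not ground states): no instance.  Barriers:
   IcosahedralClusters / TetrahedralFrustration bite exactly as catalogued (the route's declared bet,
   confined to `CoarseGrains`); KissingTwelveDegeneracy / ShortRangeStackingBlindness / HcpNotBravais are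
   respected by the statement's shape (two sublattices, full-tail energetics upstream, stacking ASSERTED
   not inferred).  Literature search this cycle was degraded (OpenAlex/S2 HTTP 429, local FTS down);
   cites are the route's own keys.

## HANDOFF for re-arm
Proposed under `Theorems/FineGrains/Negative/` (verdicts pending at publication; until they are built
this file carries its own copies of every lemma): LoadBearing = p80322 (review-queued: new defs),
RadiusVacuity = p80678 (review-queued: `norm_sq_eq` near-duplicates `Literature.Geometry.Lorentzian.E3.
norm_sq`; an inlined v2 is ready in the seat folder if it bounces), FccObstruction (split at the 400-line
lint: the `1/40` variant goes to a companion `FccObstructionCoarse` importing it, to be filed once the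
first is built), HcpModel — p-ids in the seat's NOTES.md.  Sorried here: nothing.  Next regimes if re-armed with targets:
the lead's stuck stubs of whichever line is picked (GrainsGlue-type compactness: watch for (i) data
normalisation `t mod AΛ` with COLLAPSING sublattices `t 1 − t 0 → AΛ`, (ii) `Near` passing to local
limits needs closed balls/closed tolerance — both are closed here ✓, (iii) the limit datum's offset class
must be shown hcp-like before `HcpLiouville` (which assumes `Inner`) applies — THIS is the one place
where the missing `Inner` clause of FineGrains costs the prover something: CoarseGrains supplies
`Inner` for the coarse data, and `Inner` is closed under limits ✓); a certified `N ≤ 4` simplex lemma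
if a line wants explicit small-`N` exclusions; the exact covering radius `1` of `Λ` if a line needs the
sharp threshold `199/200`.
NEXT-CYCLE CANDIDATE (not formalised): a POLYTYPE obstruction — a fine ball inside ANY Barlow stacking
forces the layers in the ball to be hcp-stacked (the c-period pair forces aligned second-neighbour
layers at every site; in-plane steps cannot tilt because `|⟨Au, A·2√(2/3)e₃⟩| ≤ 0.08` while an
interlayer bond has height `h ≈ 0.79`); it would upgrade (g) from "fcc fails" to "every non-hcp
stacking fails", i.e. `FineGrains` detects exactly hcp among Barlow stackings.
-/

noncomputable section

open Literature.MathematicalPhysics.StatisticalMechanics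
open Summit.AtomisticToContinuum.Crystallization.Theorems.CoarseGrains.Negative
open Summit.AtomisticToContinuum.Crystallization.Theorems.CoarseGrains.Negative.PredicateAPI
open Summit.AtomisticToContinuum.Crystallization.Theorems.CoarseGrains.Negative.LoadBearing
open Summit.AtomisticToContinuum.Crystallization.Theorems.CoarseGrains.Negative.CubicThreshold
open Summit.AtomisticToContinuum.Crystallization.Theorems.CoarseGrains.Negative.VacuityThreshold

namespace Summit.AtomisticToContinuum.Crystallization.Cruxes.FineGrains.Disproof

/-! ## The crux unfolded -/

/-- The matrix of the crux for one configuration: `x` has a closed ball `B_ρ(c)` two-way `ε`-matched with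
the sites `t m + A z` (`m : Fin 2`, `z ∈ Λ`) of an admissible datum (`Adm A`; NO inner-displacement
constraint on `t`, unlike `CoarseGrains`). -/
def HasFineBall (ρ ε : ℝ) {N : ℕ} (x : Fin N → E3) : Prop :=
  ∃ (c : E3) (t : Fin 2 → E3) (A : E3 →L[ℝ] E3), Adm A ∧ Near (Set.range x) c ρ t A ε

/-- `FineGrains` is, definitionally, `∀ ρ ε > 0 ∃ N₀ ∀ N ≥ N₀ ∀ ground states x, HasFineBall ρ ε x`. -/
theorem fineGrains_iff :
    Theses.ExcessDecayLiouville.FineGrains ↔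
    ∀ ρ ε : ℝ, 0 < ρ → 0 < ε → ∃ N₀ : ℕ, ∀ N : ℕ, N₀ ≤ N → ∀ x : Fin N → E3,
      IsGroundState lennardJones x → HasFineBall ρ ε x :=
  Iff.rfl

/-! ## Monotonicity: the matrix is antitone in the radius and monotone in the tolerance -/

/-- Two-way matching is antitone in the radius and monotone in the tolerance. [folklore] -/
theorem near_mono {X : Set E3} {c : E3} {r r' ε ε' : ℝ} {t : Fin 2 → E3} {A : E3 →L[ℝ] E3}
    (hr : r' ≤ r) (hε : ε ≤ ε') (hN : Near X c r t A ε) : Near X c r' t A ε' :=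
  ⟨fun p hp hpc => by
    obtain ⟨m, z, hz, hd⟩ := hN.1 p hp (hpc.trans hr)
    exact ⟨m, z, hz, hd.trans hε⟩,
   fun m z hz hzc => by
    obtain ⟨p, hp, hd⟩ := hN.2 m z hz (hzc.trans hr)
    exact ⟨p, hp, hd.trans hε⟩⟩

/-- The matrix is antitone in `ρ` and monotone in `ε`. [folklore] -/
theorem hasFineBall_mono {ρ ρ' ε ε' : ℝ} {N : ℕ} {x : Fin N → E3} (hρ : ρ' ≤ ρ) (hε : ε ≤ ε')
    (h : HasFineBall ρ ε x) : HasFineBall ρ' ε' x := by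
  obtain ⟨c, t, A, hA, hN⟩ := h
  exact ⟨c, t, A, hA, near_mono hρ hε hN⟩

/-- **Provers may assume `ρ ≥ ρ₁` and `ε ≤ ε₁`** for any fixed `ρ₁` and `ε₁ > 0`: the crux follows from
its instances at large radius and small tolerance. [folklore] -/
theorem fineGrains_of_large_radius_small_tol (ρ₁ ε₁ : ℝ) (hε₁ : 0 < ε₁)
    (h : ∀ ρ ε : ℝ, ρ₁ ≤ ρ → 0 < ε → ε ≤ ε₁ → ∃ N₀ : ℕ, ∀ N : ℕ, N₀ ≤ N → ∀ x : Fin N → E3,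
      IsGroundState lennardJones x → HasFineBall ρ ε x) :
    Theses.ExcessDecayLiouville.FineGrains := by
  rw [fineGrains_iff]
  intro ρ ε _ hε
  obtain ⟨N₀, hN₀⟩ := h (max ρ ρ₁) (min ε ε₁) (le_max_right _ _) (lt_min hε hε₁) (min_le_right _ _)
  exact ⟨N₀, fun N hN x hx => hasFineBall_mono (le_max_left _ _) (min_le_left _ _) (hN₀ N hN x hx)⟩

/-- **`0 < ρ` is decoration** (the matrix only weakens as `ρ` shrinks); `0 < ε` is not (for `ε < 0` the
matrix fails as soon as a site lies in the ball, and `ε = 0` is the unrefuted "exact grains"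
strengthening discussed in the docblock). [folklore] -/
theorem fineGrains_iff_forall_radius :
    Theses.ExcessDecayLiouville.FineGrains ↔
    ∀ ρ ε : ℝ, 0 < ε → ∃ N₀ : ℕ, ∀ N : ℕ, N₀ ≤ N → ∀ x : Fin N → E3,
      IsGroundState lennardJones x → HasFineBall ρ ε x := by
  constructor
  · intro h ρ ε hε
    rw [fineGrains_iff] at h
    obtain ⟨N₀, hN₀⟩ := h (max ρ 1) ε (lt_of_lt_of_le one_pos (le_max_right _ _)) hε
    exact ⟨N₀, fun N hN x hx => hasFineBall_mono (le_max_left _ _) le_rfl (hN₀ N hN x hx)⟩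
  · intro h
    exact fineGrains_of_large_radius_small_tol 0 1 one_pos fun ρ ε _ hε _ => h ρ ε hε


/-! ## (a) Load-bearing hypotheses: any proof must use MINIMALITY and LARGENESS -/

/-- `FineGrains` with the ground-state hypothesis weakened to mere injectivity. -/
def FineGrainsWithoutMinimality : Prop :=
  ∀ ρ ε : ℝ, 0 < ρ → 0 < ε → ∃ N₀ : ℕ, ∀ N : ℕ, N₀ ≤ N → ∀ x : Fin N → E3,
    Function.Injective x → HasFineBall ρ ε x

/-- The collinear gas: `N` particles at `0, 10u, 20u, …` (`u = triangularVec₁ 1`). -/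
def gas (N : ℕ) : Fin N → E3 := fun i => ((10 : ℝ) * (i : ℕ)) • (triangularVec₁ 1 : E3)

/-- The gas is injective. [folklore] -/
theorem gas_injective (N : ℕ) : Function.Injective (gas N) := by
  intro i j hij
  have hu1 : ‖(triangularVec₁ 1 : E3)‖ = 1 := norm_triangularVec₁
  have hu0 : (triangularVec₁ 1 : E3) ≠ 0 := by
    intro h0; rw [h0, norm_zero] at hu1; norm_num at hu1
  have h1 : (10 : ℝ) * (i : ℕ) = 10 * (j : ℕ) := smul_left_injective ℝ hu0 hij
  exact Fin.ext (by exact_mod_cast (mul_left_cancel₀ (by norm_num : (10 : ℝ) ≠ 0) h1))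

/-- Distinct gas particles are `≥ 10` apart. [folklore] -/
theorem gas_far (N : ℕ) {i j : Fin N} (hij : i ≠ j) : 10 ≤ dist (gas N i) (gas N j) := by
  have hu1 : ‖(triangularVec₁ 1 : E3)‖ = 1 := norm_triangularVec₁
  have hij' : (i : ℕ) ≠ (j : ℕ) := Fin.val_ne_of_ne hij
  have h1 : (1 : ℝ) ≤ |((i : ℕ) : ℝ) - ((j : ℕ) : ℝ)| := by
    rcases Nat.lt_or_gt_of_ne hij' with hlt | hlt
    · have : ((i : ℕ) : ℝ) + 1 ≤ ((j : ℕ) : ℝ) := by exact_mod_cast hlt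
      rw [abs_sub_comm]; exact le_trans (by linarith) (le_abs_self _)
    · have : ((j : ℕ) : ℝ) + 1 ≤ ((i : ℕ) : ℝ) := by exact_mod_cast hlt
      exact le_trans (by linarith) (le_abs_self _)
  have h2 : dist (gas N i) (gas N j) = 10 * |((i : ℕ) : ℝ) - ((j : ℕ) : ℝ)| := by
    change dist (((10 : ℝ) * (i : ℕ)) • (triangularVec₁ 1 : E3))
      (((10 : ℝ) * (j : ℕ)) • (triangularVec₁ 1 : E3)) = _
    rw [dist_eq_norm, ← sub_smul, norm_smul, hu1, mul_one, ← mul_sub, Real.norm_eq_abs, abs_mul,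
      abs_of_pos (by norm_num : (0 : ℝ) < 10)]
  rw [h2]; linarith

/-- **A matched ball of radius `≥ 21/10` forces a bond of length in `[189/200 − 2ε, 199/200 + 2ε]`:**
the site `t 0 + A z` within `11/10` of the centre and its neighbour `t 0 + A (z + u)` both lie in the
ball, are `‖A u‖ ∈ [189/200, 199/200]` apart, and each owns a particle within `ε`; for `ε < 189/400` the
two particles are distinct.  Uses only clause (ii) of `Near` and `Adm` (nothing about `t 1`). [folklore] -/
theorem exists_bond_of_near {N : ℕ} {x : Fin N → E3} {c : E3} {t : Fin 2 → E3} {A : E3 →L[ℝ] E3}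
    (hA : Adm A) {ρ ε : ℝ} (hρ : 21 / 10 ≤ ρ) (hε : ε < 189 / 400)
    (hN : Near (Set.range x) c ρ t A ε) :
    ∃ i j : Fin N, i ≠ j ∧ 189 / 200 - 2 * ε ≤ dist (x i) (x j) ∧ dist (x i) (x j) ≤ 199 / 200 + 2 * ε := by
  set u : E3 := triangularVec₁ 1 with hu
  have hu1 : ‖u‖ = 1 := norm_triangularVec₁
  have hu0 : u ≠ 0 := by intro h0; rw [h0, norm_zero] at hu1; norm_num at hu1
  obtain ⟨z, hz, hzc⟩ := exists_site_near hA (t 0) c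
  have hzu : z + u ∈ Lam := lam_add_mem hz triangularVec₁_mem_lam
  have hAu : ‖A u‖ ≤ 199 / 200 := by simpa [hu1] using adm_norm_le hA u
  have hAu' : 189 / 200 ≤ ‖A u‖ := by simpa [hu1] using adm_le_norm hA u
  have hd : dist (t 0 + A (z + u)) (t 0 + A z) = ‖A u‖ := by
    rw [dist_site_site]; congr 1; abel_nf
  have hzuc : dist (t 0 + A (z + u)) c ≤ ρ := by
    calc dist (t 0 + A (z + u)) c ≤ dist (t 0 + A (z + u)) (t 0 + A z) + dist (t 0 + A z) c :=
          dist_triangle _ _ _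
      _ ≤ 199 / 200 + 11 / 10 := by rw [hd]; linarith
      _ ≤ ρ := by linarith
  obtain ⟨p, ⟨i, rfl⟩, hp⟩ := hN.2 0 z hz (by linarith)
  obtain ⟨q, ⟨j, rfl⟩, hq⟩ := hN.2 0 (z + u) hzu hzuc
  refine ⟨i, j, ?_, ?_, ?_⟩
  · intro hij
    subst hij
    have hclose : dist (t 0 + A z) (t 0 + A (z + u)) ≤ ε + ε := by
      calc _ ≤ dist (t 0 + A z) (x i) + dist (x i) (t 0 + A (z + u)) := dist_triangle _ _ _
        _ ≤ ε + ε := by rw [dist_comm]; gcongr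
    rw [dist_comm, hd] at hclose
    linarith
  · have h1 : dist (t 0 + A z) (t 0 + A (z + u)) ≤ dist (t 0 + A z) (x i) + dist (x i) (x j) +
        dist (x j) (t 0 + A (z + u)) := dist_triangle4 _ _ _ _
    rw [dist_comm (t 0 + A z) (t 0 + A (z + u)), hd, dist_comm (t 0 + A z) (x i)] at h1
    linarith
  · calc dist (x i) (x j) ≤ dist (x i) (t 0 + A z) + dist (t 0 + A z) (t 0 + A (z + u)) +
          dist (t 0 + A (z + u)) (x j) := dist_triangle4 _ _ _ _
      _ ≤ ε + 199 / 200 + ε := by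
        gcongr
        · rw [dist_comm, hd]; exact hAu
        · rw [dist_comm]; exact hq
      _ = 199 / 200 + 2 * ε := by ring


/-- **No ball of radius `≥ 21/10` of the gas is two-way `ε`-matched with an admissible datum for
`ε < 189/400`:** the bond forced by `exists_bond_of_near` would be `< 10` long, but distinct gas particles
are `≥ 10` apart. [folklore] -/
theorem not_near_gas (N : ℕ) {c : E3} {t : Fin 2 → E3} {A : E3 →L[ℝ] E3} (hA : Adm A) {ρ ε : ℝ}
    (hρ : 21 / 10 ≤ ρ) (hε : ε < 189 / 400) : ¬ Near (Set.range (gas N)) c ρ t A ε := by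
  intro hN
  obtain ⟨i, j, hij, -, hle⟩ := exists_bond_of_near hA hρ hε hN
  have h10 := gas_far N hij
  linarith

/-- **`FineGrains` forces bonds near the window:** if the crux holds then for every `ε ∈ (0, 189/400)`
all large ground states contain two particles at distance in `[189/200 − 2ε, 199/200 + 2ε]` — the
cheapest necessary condition to test numerically (relaxed LJ bulk bonds are `≈ 0.971`). [folklore] -/
theorem fineGrains_forces_bonds (h : Theses.ExcessDecayLiouville.FineGrains) {ε : ℝ} (hε : 0 < ε)
    (hε' : ε < 189 / 400) :
    ∃ N₀ : ℕ, ∀ N : ℕ, N₀ ≤ N → ∀ x : Fin N → E3, IsGroundState lennardJones x →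
      ∃ i j : Fin N, i ≠ j ∧ 189 / 200 - 2 * ε ≤ dist (x i) (x j) ∧
        dist (x i) (x j) ≤ 199 / 200 + 2 * ε := by
  rw [fineGrains_iff] at h
  obtain ⟨N₀, hN₀⟩ := h (21 / 10) ε (by norm_num) hε
  refine ⟨N₀, fun N hN x hx => ?_⟩
  obtain ⟨c, t, A, hA, hNear⟩ := hN₀ N hN x hx
  exact exists_bond_of_near hA le_rfl hε' hNear

/-- **Minimality is load-bearing**: for arbitrary injective configurations the statement fails at
`(ρ, ε) = (3, 1/40)` (the collinear gas of any size). [folklore] -/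
theorem fineGrains_false_without_minimality : ¬ FineGrainsWithoutMinimality := by
  intro h
  obtain ⟨N₀, hN₀⟩ := h 3 (1 / 40) (by norm_num) (by norm_num)
  obtain ⟨c, t, A, hA, hN⟩ := hN₀ N₀ le_rfl (gas N₀) (gas_injective N₀)
  exact not_near_gas N₀ hA (by norm_num) (by norm_num) hN

/-- `FineGrains` with the largeness hypothesis `N ≥ N₀` dropped (every ground state of every size). -/
def FineGrainsWithoutLargeness : Prop :=
  ∀ ρ ε : ℝ, 0 < ρ → 0 < ε → ∀ (N : ℕ) (x : Fin N → E3), IsGroundState lennardJones x →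
    HasFineBall ρ ε x

/-- The EMPTY configuration has no matched ball of radius `≥ 11/10`, at any tolerance: the site within
`11/10` of the centre has no particle to own it. [folklore] -/
theorem not_hasFineBall_fin_zero {ρ ε : ℝ} (hρ : 11 / 10 ≤ ρ) (x : Fin 0 → E3) :
    ¬ HasFineBall ρ ε x := by
  rintro ⟨c, t, A, hA, hN⟩
  obtain ⟨z, hz, hzc⟩ := exists_site_near hA (t 0) c
  obtain ⟨p, ⟨i, _⟩, _⟩ := hN.2 0 z hz (hzc.trans hρ)
  exact i.elim0

/-- **Largeness is load-bearing**: the empty ground state (`isGroundState_fin_zero`) refutes the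
statement without `N ≥ N₀` at `(ρ, ε) = (2, 1)` — indeed at every `ρ ≥ 11/10` and EVERY `ε`. [folklore] -/
theorem fineGrains_false_without_largeness : ¬ FineGrainsWithoutLargeness := fun h =>
  not_hasFineBall_fin_zero (by norm_num : (11 : ℝ) / 10 ≤ 2) _
    (h 2 1 (by norm_num) (by norm_num) 0 (fun i => i.elim0) (isGroundState_fin_zero _))

/-- Orientation: `FineGrainsWithoutLargeness → FineGrains` (take `N₀ := 0`). [folklore] -/
theorem fineGrains_of_withoutLargeness :
    FineGrainsWithoutLargeness → Theses.ExcessDecayLiouville.FineGrains :=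
  fun h ρ ε hρ hε => ⟨0, fun N _ x hx => h ρ ε hρ hε N x hx⟩

/-- Orientation: `FineGrainsWithoutMinimality → FineGrains` (ground states are injective). [folklore] -/
theorem fineGrains_of_withoutMinimality :
    FineGrainsWithoutMinimality → Theses.ExcessDecayLiouville.FineGrains :=
  fun h ρ ε hρ hε => by
    obtain ⟨N₀, hN₀⟩ := h ρ ε hρ hε
    exact ⟨N₀, fun N hN x hx => hN₀ N hN x hx.1⟩

/-! ## (a′) How large `N₀(ρ, ε)` must be: `≥ 1` from `ρ ≥ 11/10` (any `ε`), `≥ ((ρ − 11/10)/4)³` for `ε ≤ 1/40` -/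

/-- Any threshold `N₀` valid at a radius `ρ ≥ 11/10` is `≥ 1` (test on the empty ground state). [folklore] -/
theorem one_le_threshold {ρ ε : ℝ} (hρ : 11 / 10 ≤ ρ) {N₀ : ℕ}
    (h : ∀ N : ℕ, N₀ ≤ N → ∀ x : Fin N → E3, IsGroundState lennardJones x → HasFineBall ρ ε x) :
    1 ≤ N₀ := by
  rcases Nat.eq_zero_or_pos N₀ with h0 | h0
  · subst h0
    exact absurd (h 0 le_rfl (fun i => i.elim0) (isGroundState_fin_zero _))
      (not_hasFineBall_fin_zero hρ _)
  · exact h0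

/-- **`N₀(ρ, ε)` is at least cubic in `ρ`** for `ε ≤ 1/40`: a threshold valid at radius
`ρ ≥ 11/10 + 4K` satisfies `(K+1)³ ≤ N₀` (a matched ball holds `(K+1)³` sites `≥ 189/200` apart, each
owning its own particle; test on a ground state with exactly `N₀` particles,
`LennardJonesGroundStatesExist_holds`).  Reuses `CubicThreshold.cube_le_card_of_near`. [folklore] -/
theorem threshold_cubic {ρ ε : ℝ} (hε : ε ≤ 1 / 40) {N₀ : ℕ}
    (h : ∀ N : ℕ, N₀ ≤ N → ∀ x : Fin N → E3, IsGroundState lennardJones x → HasFineBall ρ ε x)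
    (K : ℕ) (hR : 11 / 10 + 4 * K ≤ ρ) : (K + 1) ^ 3 ≤ N₀ := by
  obtain ⟨x, hx⟩ := LennardJonesGroundStatesExist_holds N₀
  obtain ⟨c, t, A, hA, hN⟩ := h N₀ le_rfl x hx
  exact cube_le_card_of_near hA (near_mono le_rfl hε hN) K hR

/-! ## (c) Natural strengthenings refuted -/

/-- **No `N₀` uniform in `ρ`:** the quantifier swap `∃ N₀ ∀ ρ ε` is false (a ground state of `N₀`
particles cannot fill a matched ball of radius `11/10 + 4N₀`). [folklore] -/
theorem not_fineGrains_uniform_radius :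
    ¬ ∃ N₀ : ℕ, ∀ ρ ε : ℝ, 0 < ρ → 0 < ε → ∀ N : ℕ, N₀ ≤ N → ∀ x : Fin N → E3,
      IsGroundState lennardJones x → HasFineBall ρ ε x := by
  rintro ⟨N₀, h⟩
  have := threshold_cubic (le_refl (1 / 40 : ℝ))
    (fun N hN x hx => h (11 / 10 + 4 * N₀) (1 / 40) (by positivity) (by norm_num) N hN x hx) N₀ le_rfl
  have h1 : N₀ + 1 ≤ (N₀ + 1) ^ 3 := Nat.le_self_pow (by norm_num) _
  omega

/-- **Negative tolerance is contradictory** (so `0 < ε`, or at least `0 ≤ ε`, is needed): for `ε < 0`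
no configuration has a matched ball of radius `≥ 11/10`. [folklore] -/
theorem not_hasFineBall_of_neg {ρ ε : ℝ} (hρ : 11 / 10 ≤ ρ) (hε : ε < 0) {N : ℕ} (x : Fin N → E3) :
    ¬ HasFineBall ρ ε x := by
  rintro ⟨c, t, A, hA, hN⟩
  obtain ⟨z, hz, hzc⟩ := exists_site_near hA (t 0) c
  obtain ⟨p, _, hp⟩ := hN.2 0 z hz (hzc.trans hρ)
  exact absurd (lt_of_le_of_lt hp hε) (not_lt.2 dist_nonneg)


/-! ## (b) Vacuity in the radius: for `ρ < 199/200` the matrix holds for EVERY bounded set at EVERY `ε`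

Specific to `FineGrains`: the inner displacement is free, so the COLLAPSED datum `t 0 = t 1` is allowed;
its site set is the Bravais lattice `F + s·Λ` (`s = 199/200`, admissible with equality), whose deep hole
`F + s(w + √(2/3)e₃)` is at distance `≥ s` from every site (`Λ` has covering radius exactly `1`).  For
`CoarseGrains`, whose `Inner` forbids the collapse, the sibling seat's threshold is `7/10`
(`VacuityThreshold.near_trivial_of_le`); from `ρ ≥ 11/10` the matrix has content in both
(`one_le_threshold`). -/

/-- Coordinates of the deep hole `w + √(2/3)e₃ = (1/2, √3/6, √(2/3))` of `Λ` (`w = barlowOffset 1`).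
[folklore] -/
theorem hole_apply :
    (barlowOffset 1 + layerNormal (Real.sqrt (2 / 3)) : E3) 0 = 1 / 2 ∧
    (barlowOffset 1 + layerNormal (Real.sqrt (2 / 3)) : E3) 1 = Real.sqrt 3 / 6 ∧
    (barlowOffset 1 + layerNormal (Real.sqrt (2 / 3)) : E3) 2 = Real.sqrt (2 / 3) := by
  refine ⟨?_, ?_, ?_⟩ <;> simp [barlowOffset, layerNormal]

/-- `‖w‖² = w₀² + w₁² + w₂²` in `ℝ³`. [folklore] -/
theorem norm_sq_eq (w : E3) : ‖w‖ ^ 2 = w 0 ^ 2 + w 1 ^ 2 + w 2 ^ 2 := by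
  rw [EuclideanSpace.norm_eq, Real.sq_sqrt (by positivity), Fin.sum_univ_three]
  simp [Real.norm_eq_abs, sq_abs]

/-- The deep hole has norm `≤ 1` (indeed `= 1`). [folklore] -/
theorem norm_hole_le_one : ‖(barlowOffset 1 + layerNormal (Real.sqrt (2 / 3)) : E3)‖ ≤ 1 := by
  obtain ⟨g0, g1, g2⟩ := hole_apply
  have hsq : ‖(barlowOffset 1 + layerNormal (Real.sqrt (2 / 3)) : E3)‖ ^ 2 ≤ 1 := by
    rw [norm_sq_eq, g0, g1, g2]
    nlinarith [Real.sq_sqrt (show (0 : ℝ) ≤ 3 by norm_num), sqrt23_sq]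
  nlinarith [norm_nonneg (barlowOffset 1 + layerNormal (Real.sqrt (2 / 3)) : E3)]

/-- `i² + ij + j² − i − j ≥ 0` on `ℤ²` (`int_quad_nonneg₁` at `(−i, −j)`). [folklore] -/
theorem int_quad_nonneg₃ (i j : ℤ) : 0 ≤ i * i + i * j + j * j - i - j := by
  have h := int_quad_nonneg₁ (-i) (-j)
  nlinarith [h]

/-- Real form of `int_quad_nonneg₃`. -/
theorem real_quad_nonneg₃ (i j : ℤ) : (0 : ℝ) ≤ (i : ℝ) * i + i * j + j * j - i - j := by
  exact_mod_cast int_quad_nonneg₃ i j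

/-- `(2k − 1)² ≥ 1` for `k ∈ ℤ`. [folklore] -/
theorem one_le_sq_two_mul_sub_one (k : ℤ) : (1 : ℝ) ≤ (2 * (k : ℝ) - 1) ^ 2 := by
  have h : (1 : ℤ) ≤ (2 * k - 1) ^ 2 := by
    rcases le_or_gt k 0 with hk | hk <;> nlinarith
  exact_mod_cast h

/-- **Every vector of `Λ` is at distance `≥ 1` from the deep hole** `w + √(2/3)e₃`:
`‖z − hole‖² = (i² + ij + j² − i − j + 1/3) + (2/3)(2k − 1)² ≥ 1/3 + 2/3`. [folklore] -/
theorem one_le_norm_sq_lam_sub_hole (i j k : ℤ) :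
    (1 : ℝ) ≤ ‖((i : ℝ) • triangularVec₁ 1 + (j : ℝ) • triangularVec₂ 1 +
      (k : ℝ) • layerNormal (2 * Real.sqrt (2 / 3)) : E3) -
      (barlowOffset 1 + layerNormal (Real.sqrt (2 / 3)))‖ ^ 2 := by
  obtain ⟨g0, g1, g2⟩ := hole_apply
  obtain ⟨h0, h1, h2⟩ := lamVec_apply (i : ℝ) j k
  rw [norm_sq_eq]
  simp only [PiLp.sub_apply]
  rw [h0, h1, h2, g0, g1, g2]
  have h3 : Real.sqrt 3 ^ 2 = 3 := Real.sq_sqrt (by norm_num)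
  have e1 : ((j : ℝ) * (Real.sqrt 3 / 2) - Real.sqrt 3 / 6) ^ 2 = 3 * ((j : ℝ) / 2 - 1 / 6) ^ 2 := by
    have : (j : ℝ) * (Real.sqrt 3 / 2) - Real.sqrt 3 / 6 = Real.sqrt 3 * ((j : ℝ) / 2 - 1 / 6) := by
      ring
    rw [this, mul_pow, h3]
  have e2 : ((k : ℝ) * (2 * Real.sqrt (2 / 3)) - Real.sqrt (2 / 3)) ^ 2 =
      2 / 3 * (2 * (k : ℝ) - 1) ^ 2 := by
    have : (k : ℝ) * (2 * Real.sqrt (2 / 3)) - Real.sqrt (2 / 3) =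
        Real.sqrt (2 / 3) * (2 * (k : ℝ) - 1) := by ring
    rw [this, mul_pow, sqrt23_sq]
  rw [e1, e2]
  have hq := real_quad_nonneg₃ i j
  have hk := one_le_sq_two_mul_sub_one k
  nlinarith [hq, hk]

/-- **Below radius `199/200` the matrix is vacuous — for every bounded `X` and EVERY real `ε`** (even
`ε ≤ 0`): collapsed datum `A = (199/200)·id` (admissible, with equality `‖A − 0.97·id‖ = 1/40`),
`t 0 = t 1 = F` parked farther than `ρ` from `X`, ball centred at the deep hole `c = F + A(w + √(2/3)e₃)`;
every site `F + A z` is `≥ 199/200 > ρ` from `c` (`one_le_norm_sq_lam_sub_hole`) and no point of `X` is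
within `ρ` of `c`, so both clauses of `Near` are vacuous. [folklore] -/
theorem near_trivial_collapsed {ρ : ℝ} (hρ : ρ < 199 / 200) {X : Set E3} (hX : Bornology.IsBounded X)
    (ε : ℝ) :
    ∃ (c : E3) (t : Fin 2 → E3) (A : E3 →L[ℝ] E3), Adm A ∧ Near X c ρ t A ε := by
  obtain ⟨M, hMpos, hM⟩ := hX.exists_pos_norm_le
  have hhole_norm := norm_hole_le_one
  set hole : E3 := barlowOffset 1 + layerNormal (Real.sqrt (2 / 3)) with hhole
  set u : E3 := triangularVec₁ 1 with hu
  have hu1 : ‖u‖ = 1 := norm_triangularVec₁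
  set A : E3 →L[ℝ] E3 := (199 / 200 : ℝ) • ContinuousLinearMap.id ℝ E3 with hAdef
  have hA : ∀ w : E3, A w = (199 / 200 : ℝ) • w := fun w => by simp [hAdef]
  set F : E3 := (M + 3) • u with hF
  set t : Fin 2 → E3 := ![F, F] with ht
  set c : E3 := F + A hole with hc
  have htm : ∀ m : Fin 2, t m = F := by
    intro m
    fin_cases m <;> simp [ht]
  refine ⟨c, t, A, ?_, ?_, ?_⟩
  · refine ⟨LinearIsometryEquiv.refl ℝ E3, ?_⟩
    have h0 : A - (97 / 100 : ℝ) •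
        ((LinearIsometryEquiv.refl ℝ E3).toContinuousLinearEquiv : E3 →L[ℝ] E3) =
        (1 / 40 : ℝ) • ContinuousLinearMap.id ℝ E3 := by
      ext w
      simp [hAdef]
      ring
    rw [h0, norm_smul, ContinuousLinearMap.norm_id, Real.norm_eq_abs]
    norm_num
  · intro p hp hpc
    exfalso
    have h1 : ‖F‖ = M + 3 := by
      rw [hF, norm_smul, hu1, mul_one, Real.norm_eq_abs, abs_of_pos (by linarith)]
    have h2 : ‖A hole‖ ≤ 1 := by
      rw [hA, norm_smul, Real.norm_eq_abs, abs_of_pos (by norm_num)]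
      nlinarith [norm_nonneg hole]
    have h3 : ‖F‖ - ‖A hole‖ ≤ ‖c‖ := by rw [hc]; exact norm_sub_le_norm_add _ _
    have h4 : ‖c‖ - ‖p‖ ≤ dist p c := by
      rw [dist_comm, dist_eq_norm]; exact norm_sub_norm_le c p
    have h5 := hM p hp
    linarith
  · intro m z hz hzc
    exfalso
    obtain ⟨i, j, k, rfl⟩ := hz
    set zz : E3 := (i : ℝ) • triangularVec₁ 1 + (j : ℝ) • triangularVec₂ 1 +
      (k : ℝ) • layerNormal (2 * Real.sqrt (2 / 3)) with hzz
    rw [htm m, hc, dist_eq_norm] at hzc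
    have e : F + A zz - (F + A hole) = A (zz - hole) := by rw [map_sub]; abel
    rw [e, hA, norm_smul, Real.norm_eq_abs, abs_of_pos (by norm_num)] at hzc
    have hsq := one_le_norm_sq_lam_sub_hole i j k
    have hn : 1 ≤ ‖zz - hole‖ := by
      nlinarith [norm_nonneg (zz - hole), hsq]
    linarith

/-- Corollary: **for `ρ < 199/200` every finite configuration has a fine ball at every tolerance** — the
radius quantifier of `FineGrains` carries content only from `ρ ≥ 199/200` on (provers may take
`N₀ := 0` below); the threshold is bracketed by `one_le_threshold` (`ρ ≥ 11/10 ⇒ N₀ ≥ 1`). [folklore] -/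
theorem hasFineBall_of_lt {ρ : ℝ} (hρ : ρ < 199 / 200) (ε : ℝ) {N : ℕ} (x : Fin N → E3) :
    HasFineBall ρ ε x :=
  near_trivial_collapsed hρ (Set.finite_range x).isBounded ε


/-! ## (b′) Vacuity in the tolerance: for `ε ≥ max(ρ, 11/10)` every non-empty configuration has a fine ball

Centre the ball at a particle `p` and take the isotropic datum `0.97·id` based at `p`: every site in
`B_ρ(p)` is within `ρ ≤ ε` of `p`, and every particle is within the covering radius `11/10 ≤ ε` of a site.
So the tolerance quantifier carries content only for `ε < max(ρ, 11/10)`; together with (b) the contentful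
parameter region of the crux is `ρ ≥ 199/200`, `0 < ε < max(ρ, 11/10)` (and `ε → 0` is where it lives). -/

/-- The isotropic cell `0.97·id` is admissible. [folklore] -/
theorem adm_smul_id : Adm ((97 / 100 : ℝ) • ContinuousLinearMap.id ℝ E3) := by
  refine ⟨LinearIsometryEquiv.refl ℝ E3, ?_⟩
  have h0 : (97 / 100 : ℝ) • ContinuousLinearMap.id ℝ E3 - (97 / 100 : ℝ) •
      ((LinearIsometryEquiv.refl ℝ E3).toContinuousLinearEquiv : E3 →L[ℝ] E3) = 0 := by
    ext w
    simp
  rw [h0, norm_zero]; norm_num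

/-- **Large tolerance is vacuous:** for `ρ ≤ ε`, `11/10 ≤ ε` and `N ≥ 1` every configuration has a fine
ball (centred at a particle, datum `0.97·id` based there). [folklore] -/
theorem hasFineBall_of_large_tol {ρ ε : ℝ} (hρε : ρ ≤ ε) (hε : 11 / 10 ≤ ε) {N : ℕ} (hN : 1 ≤ N)
    (x : Fin N → E3) : HasFineBall ρ ε x := by
  set p : E3 := x ⟨0, hN⟩ with hp
  set A : E3 →L[ℝ] E3 := (97 / 100 : ℝ) • ContinuousLinearMap.id ℝ E3 with hAdef
  have hA : Adm A := adm_smul_id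
  refine ⟨p, ![p, p], A, hA, ?_, ?_⟩
  · intro q _ _
    obtain ⟨z, hz, hzq⟩ := exists_site_near hA p q
    refine ⟨0, z, hz, ?_⟩
    have h0 : (![p, p] : Fin 2 → E3) 0 = p := by simp
    rw [h0, dist_comm]
    exact hzq.trans hε
  · intro m z _ hzc
    exact ⟨p, ⟨⟨0, hN⟩, rfl⟩, by rw [dist_comm]; exact hzc.trans hρε⟩

/-! ## (b″) The sharp covering radius: `Λ` covers `ℝ³` at radius `1`, admissible site sets at `199/200`

Hence the vacuity threshold of (b) is EXACT: below `199/200` the matrix holds for every bounded set,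
from `199/200` on it fails for the empty configuration (`N₀ ≥ 1`). -/

/-- In-plane covering of the unit triangular lattice: for real lattice coordinates `(α, β)` there are
integers `(i, j)` with `(α−i)² + (α−i)(β−j) + (β−j)² ≤ 1/3` (circumradius `1/√3` of the unit triangle:
the barycentric average of the squared distances to the three vertices of the containing triangle is
`≤ 1/3`). [folklore] -/
theorem exists_int_tri_near (α β : ℝ) :
    ∃ i j : ℤ, (α - i) ^ 2 + (α - i) * (β - j) + (β - j) ^ 2 ≤ 1 / 3 := by
  set s : ℝ := Int.fract α with hs
  set t : ℝ := Int.fract β with ht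
  have hs0 : 0 ≤ s := Int.fract_nonneg α
  have hs1 : s < 1 := Int.fract_lt_one α
  have ht0 : 0 ≤ t := Int.fract_nonneg β
  have ht1 : t < 1 := Int.fract_lt_one β
  have hα : α - ⌊α⌋ = s := by rw [hs, Int.fract]
  have hβ : β - ⌊β⌋ = t := by rw [ht, Int.fract]
  -- squared distances (in the quadratic form) to the four corners of the cell
  by_cases hst : s + t ≤ 1
  · -- lower triangle: corners (0,0), (1,0), (0,1)
    by_cases h0 : s ^ 2 + s * t + t ^ 2 ≤ 1 / 3
    · exact ⟨⌊α⌋, ⌊β⌋, by rw [hα, hβ]; exact h0⟩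
    by_cases h1 : (s - 1) ^ 2 + (s - 1) * t + t ^ 2 ≤ 1 / 3
    · refine ⟨⌊α⌋ + 1, ⌊β⌋, ?_⟩
      push_cast
      have e1 : α - (⌊α⌋ + 1) = s - 1 := by linarith
      rw [e1, hβ]; exact h1
    · refine ⟨⌊α⌋, ⌊β⌋ + 1, ?_⟩
      push_cast
      have e2 : β - (⌊β⌋ + 1) = t - 1 := by linarith
      rw [hα, e2]
      push Not at h0 h1
      -- barycentric average ≤ 1/3 forces the third distance small
      nlinarith [mul_nonneg hs0 ht0, mul_nonneg hs0 (by linarith : (0:ℝ) ≤ 1 - s - t),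
        mul_nonneg ht0 (by linarith : (0:ℝ) ≤ 1 - s - t), sq_nonneg (s - t), sq_nonneg (s + t - 2/3)]
  · -- upper triangle: corners (1,1), (1,0), (0,1); substitute s' = 1 - s, t' = 1 - t
    push Not at hst
    by_cases h0 : (s - 1) ^ 2 + (s - 1) * (t - 1) + (t - 1) ^ 2 ≤ 1 / 3
    · refine ⟨⌊α⌋ + 1, ⌊β⌋ + 1, ?_⟩
      push_cast
      have e1 : α - (⌊α⌋ + 1) = s - 1 := by linarith
      have e2 : β - (⌊β⌋ + 1) = t - 1 := by linarith
      rw [e1, e2]; exact h0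
    by_cases h1 : (s - 1) ^ 2 + (s - 1) * t + t ^ 2 ≤ 1 / 3
    · refine ⟨⌊α⌋ + 1, ⌊β⌋, ?_⟩
      push_cast
      have e1 : α - (⌊α⌋ + 1) = s - 1 := by linarith
      rw [e1, hβ]; exact h1
    · refine ⟨⌊α⌋, ⌊β⌋ + 1, ?_⟩
      push_cast
      have e2 : β - (⌊β⌋ + 1) = t - 1 := by linarith
      rw [hα, e2]
      push Not at h0 h1
      nlinarith [mul_nonneg (by linarith : (0:ℝ) ≤ 1 - s) (by linarith : (0:ℝ) ≤ 1 - t),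
        mul_nonneg (by linarith : (0:ℝ) ≤ 1 - s) (by linarith : (0:ℝ) ≤ s + t - 1),
        mul_nonneg (by linarith : (0:ℝ) ≤ 1 - t) (by linarith : (0:ℝ) ≤ s + t - 1),
        sq_nonneg (s - t), sq_nonneg (s + t - 4/3)]


/-- **Sharp covering radius of `Λ`:** every point of `ℝ³` is within distance `1` of `Λ` (in-plane
circumradius `1/√3`, half layer period `√(2/3)`; `1/3 + 2/3 = 1`; attained at the deep holes). [folklore] -/
theorem exists_lam_near_one (y : E3) : ∃ z ∈ Lam, ‖y - z‖ ≤ 1 := by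
  set c₃ : ℝ := 2 * Real.sqrt (2 / 3) with hc₃
  set sr : ℝ := Real.sqrt 3 / 2 with hsr
  have hc₃pos : 0 < c₃ := by rw [hc₃]; positivity
  have hsrpos : 0 < sr := by rw [hsr]; positivity
  have hss : sr ^ 2 = 3 / 4 := by
    rw [hsr, div_pow, Real.sq_sqrt (show (0 : ℝ) ≤ 3 by norm_num)]; norm_num
  have hcc : c₃ ^ 2 = 8 / 3 := by rw [hc₃, mul_pow, sqrt23_sq]; norm_num
  -- lattice coordinates of the in-plane part
  set β : ℝ := y 1 / sr with hβ
  set α : ℝ := y 0 - β / 2 with hα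
  obtain ⟨i, j, hij⟩ := exists_int_tri_near α β
  set k : ℤ := round (y 2 / c₃) with hk
  refine ⟨_, mem_lam i j k, ?_⟩
  set z : E3 := (i : ℝ) • triangularVec₁ 1 + (j : ℝ) • triangularVec₂ 1 +
      (k : ℝ) • layerNormal (2 * Real.sqrt (2 / 3)) with hz
  obtain ⟨h0, h1, h2⟩ := lamVec_apply (i : ℝ) j k
  have e0 : (y - z) 0 = (α - i) + (β - j) / 2 := by
    rw [PiLp.sub_apply, h0, hα]; ring
  have e1 : (y - z) 1 = sr * (β - j) := by
    rw [PiLp.sub_apply, h1, hβ, hsr]; field_simp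
  have e2 : (y - z) 2 = c₃ * (y 2 / c₃ - k) := by
    rw [PiLp.sub_apply, h2, hc₃]; field_simp
  have b2 : |(y - z) 2| ≤ c₃ * (1 / 2) := by
    rw [e2, abs_mul, abs_of_pos hc₃pos]
    exact mul_le_mul_of_nonneg_left (by rw [hk]; exact abs_sub_round _) hc₃pos.le
  have hsq : ‖y - z‖ ^ 2 ≤ 1 := by
    rw [EuclideanSpace.norm_eq, Real.sq_sqrt (by positivity), Fin.sum_univ_three]
    simp only [Real.norm_eq_abs, sq_abs]
    have a2 : (y - z) 2 ^ 2 ≤ (c₃ * (1 / 2)) ^ 2 := sq_le_sq' (abs_le.1 b2).1 (abs_le.1 b2).2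
    rw [mul_pow, hcc] at a2
    have hin : (y - z) 0 ^ 2 + (y - z) 1 ^ 2 =
        (α - i) ^ 2 + (α - i) * (β - j) + (β - j) ^ 2 := by
      rw [e0, e1, mul_pow, hss]; ring
    linarith
  nlinarith [norm_nonneg (y - z)]

/-- **Sharp covering radius of admissible site sets:** every point of `ℝ³` is within `199/200` of a
site `t₀ + A z`, `z ∈ Λ`, of any admissible datum (`A` onto, `‖A‖ ≤ 199/200`). [folklore] -/
theorem exists_site_near_sharp {A : E3 →L[ℝ] E3} (hA : Adm A) (t₀ c : E3) :
    ∃ z ∈ Lam, dist (t₀ + A z) c ≤ 199 / 200 := by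
  obtain ⟨y, hy⟩ := adm_surjective hA (c - t₀)
  obtain ⟨z, hz, hyz⟩ := exists_lam_near_one y
  refine ⟨z, hz, ?_⟩
  have h : t₀ + A z - c = A (z - y) := by rw [map_sub, hy]; abel
  rw [dist_eq_norm, h]
  calc ‖A (z - y)‖ ≤ (199 / 200) * ‖z - y‖ := adm_norm_le hA _
    _ ≤ (199 / 200) * 1 := by rw [norm_sub_rev]; gcongr
    _ = 199 / 200 := by norm_num

/-- **The vacuity threshold `199/200` is exact:** from `ρ ≥ 199/200` on, the empty configuration has
no fine ball at any tolerance (the site within `199/200` of the centre owns no particle), so any `N₀`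
valid at such a radius is `≥ 1`; below `199/200` every bounded set has one (`near_trivial_collapsed`).
[folklore] -/
theorem not_near_empty_of_le {ρ : ℝ} (hρ : 199 / 200 ≤ ρ) {c : E3} {t : Fin 2 → E3}
    {A : E3 →L[ℝ] E3} (hA : Adm A) {ε : ℝ} : ¬ Near (∅ : Set E3) c ρ t A ε := by
  intro hN
  obtain ⟨z, hz, hzc⟩ := exists_site_near_sharp hA (t 0) c
  obtain ⟨p, hp, _⟩ := hN.2 0 z hz (hzc.trans hρ)
  exact hp

/-- Configurations form: for `ρ ≥ 199/200` the empty configuration `Fin 0 → ℝ³` has no fine ball.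
[folklore] -/
theorem fineGrains_matrix_fails_empty {ρ : ℝ} (hρ : 199 / 200 ≤ ρ) (ε : ℝ) (x : Fin 0 → E3) :
    ¬ ∃ (c : E3) (t : Fin 2 → E3) (A : E3 →L[ℝ] E3), Adm A ∧ Near (Set.range x) c ρ t A ε := by
  rintro ⟨c, t, A, hA, hN⟩
  have hx : Set.range x = ∅ := Set.range_eq_empty x
  rw [hx] at hN
  exact not_near_empty_of_le hρ hA hN

/-! ## (f) Normalisation of data (infrastructure for GrainsGlue / LimitGlue-type compactness)

The site set — hence `Near` — is invariant under translating each sublattice origin by `A`(a lattice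
vector) and under swapping the sublattices; so a matched datum can always be normalised to have both
origins within the covering radius `11/10` of the centre of the ball (bounded data ⇒ compactness). -/

/-- Translating each sublattice origin by the image of a lattice vector does not change the site set,
hence not the matching. [folklore] -/
theorem near_translate {X : Set E3} {c : E3} {r ε : ℝ} {t : Fin 2 → E3} {A : E3 →L[ℝ] E3}
    (z₀ : Fin 2 → E3) (hz₀ : ∀ m, z₀ m ∈ Lam) (h : Near X c r t A ε) :
    Near X c r (fun m => t m + A (z₀ m)) A ε := by
  refine ⟨fun p hp hpc => ?_, fun m z hz hzc => ?_⟩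
  · obtain ⟨m, z, hz, hd⟩ := h.1 p hp hpc
    refine ⟨m, z - z₀ m, lam_sub_mem hz (hz₀ m), ?_⟩
    have e : t m + A (z₀ m) + A (z - z₀ m) = t m + A z := by rw [map_sub]; abel
    simpa only [e] using hd
  · have e : t m + A (z₀ m) + A z = t m + A (z₀ m + z) := by rw [map_add]; abel
    rw [e] at hzc ⊢
    exact h.2 m (z₀ m + z) (lam_add_mem (hz₀ m) hz) hzc

/-- Swapping the two sublattices does not change the site set, hence not the matching. [folklore] -/
theorem near_swap {X : Set E3} {c : E3} {r ε : ℝ} {t : Fin 2 → E3} {A : E3 →L[ℝ] E3}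
    (h : Near X c r t A ε) : Near X c r ![t 1, t 0] A ε := by
  have hm : ∀ n : Fin 2, n = 0 ∨ n = 1 := by
    intro n
    rcases n with ⟨_ | _ | n, hn⟩
    · exact Or.inl rfl
    · exact Or.inr rfl
    · omega
  have h0 : (![t 1, t 0] : Fin 2 → E3) 0 = t 1 := by simp
  have h1 : (![t 1, t 0] : Fin 2 → E3) 1 = t 0 := by simp
  refine ⟨fun p hp hpc => ?_, fun m z hz hzc => ?_⟩
  · obtain ⟨m, z, hz, hd⟩ := h.1 p hp hpc
    rcases hm m with rfl | rfl
    · exact ⟨1, z, hz, by rw [h1]; exact hd⟩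
    · exact ⟨0, z, hz, by rw [h0]; exact hd⟩
  · rcases hm m with rfl | rfl
    · rw [h0] at hzc ⊢; exact h.2 1 z hz hzc
    · rw [h1] at hzc ⊢; exact h.2 0 z hz hzc

/-- **Normalisation of data** (for compactness arguments): a matched datum may be replaced by one with
the same cell whose two sublattice origins lie within `11/10` of the centre of the ball. [folklore] -/
theorem near_normalise {X : Set E3} {c : E3} {r ε : ℝ} {t : Fin 2 → E3} {A : E3 →L[ℝ] E3}
    (hA : Adm A) (h : Near X c r t A ε) :
    ∃ t' : Fin 2 → E3, (∀ m, dist (t' m) c ≤ 11 / 10) ∧ Near X c r t' A ε := by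
  have hz : ∀ m : Fin 2, ∃ z ∈ Lam, dist (t m + A z) c ≤ 11 / 10 := fun m => exists_site_near hA (t m) c
  choose z₀ hz₀ hd using hz
  exact ⟨fun m => t m + A (z₀ m), hd, near_translate z₀ hz₀ h⟩


/-! ## (g) The fcc obstruction — the route's kill criterion, kernel-checked

`FineGrains` names hcp.  The statements below make precise that it is FALSE on fcc-type matter: no
configuration contained in an isometric image of a relaxed fcc stacking `fccStacking a h`
(`a ∈ [0.96, 0.99]`, `h ∈ [0.78, 0.81]` — a box around the relaxed Lennard-Jones fcc cell `a ≈ 0.9713`,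
`h = a√(2/3) ≈ 0.7931`) has a fine ball of radius `≥ 3` at tolerance `≤ 1/100`, whatever the free
sublattice offsets; hence `fineGrains_false_of_fccPieces`: if for infinitely many `N` some LJ ground
state is such an fcc piece, `FineGrains` fails.  (That hypothesis is believed FALSE — hcp wins the static
lattice sums by `7.25·10⁻⁵`/particle — and is deliberately NOT filed as a wanted construction.) -/

/-! ### Integer quadratic forms (sign-flipped companions of `VacuityThreshold.int_quad_nonneg₁/₂`) -/

/-- `p² + pq + q² − p − q ≥ 0` on `ℤ²`. [folklore] -/
theorem int_quad_nonneg_sub₁ (p q : ℤ) : 0 ≤ p * p + p * q + q * q - p - q := by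
  have h := int_quad_nonneg₁ (-p) (-q)
  nlinarith [h]

/-- `p² + pq + q² − 2p − 2q + 1 ≥ 0` on `ℤ²`. [folklore] -/
theorem int_quad_nonneg_sub₂ (p q : ℤ) : 0 ≤ p * p + p * q + q * q - 2 * p - 2 * q + 1 := by
  have h := int_quad_nonneg₂ (-p) (-q)
  nlinarith [h]

/-- `p² + pq + q² ∈ {0, 1} ∪ [3, ∞)` on `ℤ²` (the value `2` is not represented). [folklore] -/
theorem int_quad_le_one_or_three_le (p q : ℤ) :
    p * p + p * q + q * q ≤ 1 ∨ 3 ≤ p * p + p * q + q * q := by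
  by_contra hcon
  push Not at hcon
  obtain ⟨h1, h2⟩ := hcon
  have h3 : p * p + p * q + q * q = 2 := by omega
  -- `4·2 = (2p+q)² + 3q²` forces `q² ≤ 2`, then contradiction by cases
  have hq : q * q ≤ 2 := by nlinarith [sq_nonneg (2 * p + q)]
  have hq' : -1 ≤ q ∧ q ≤ 1 := by
    constructor <;> nlinarith [sq_nonneg (q + 1), sq_nonneg (q - 1)]
  have hp : p * p ≤ 3 := by nlinarith [sq_nonneg (2 * q + p)]
  have hp' : -1 ≤ p ∧ p ≤ 1 := by
    constructor <;> nlinarith [sq_nonneg (p + 1), sq_nonneg (p - 1)]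
  obtain ⟨hq1, hq2⟩ := hq'
  obtain ⟨hp1, hp2⟩ := hp'
  interval_cases p <;> interval_cases q <;> omega

/-! ### Squared distances in a relaxed fcc stacking avoid `(1.99, 2.74)` -/

/-- Real core of the dichotomy: `D² = a²(N + M²/3) + M²h²` with the integer side conditions of the
four layer-difference cases. [folklore] -/
theorem dichotomy_core {a h N MM : ℝ} (ha2 : (24 / 25 : ℝ) ^ 2 ≤ a ^ 2) (ha2' : a ^ 2 ≤ (99 / 100) ^ 2)
    (hh2 : (39 / 50 : ℝ) ^ 2 ≤ h ^ 2) (hh2' : h ^ 2 ≤ (81 / 100) ^ 2)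
    (hcase : (MM = 0 ∧ 0 ≤ N ∧ (N ≤ 1 ∨ 3 ≤ N)) ∨ (MM = 1 ∧ 0 ≤ N ∧ (N ≤ 1 ∨ 2 ≤ N)) ∨
      (MM = 4 ∧ -1 ≤ N) ∨ (9 ≤ MM ∧ 0 ≤ N + MM / 3)) :
    a ^ 2 * (N + MM / 3) + MM * h ^ 2 ≤ 199 / 100 ∨ 137 / 50 ≤ a ^ 2 * (N + MM / 3) + MM * h ^ 2 := by
  have ha0 : 0 ≤ a ^ 2 := sq_nonneg a
  have hh0 : 0 ≤ h ^ 2 := sq_nonneg h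
  rcases hcase with ⟨hM, hN0, hN | hN⟩ | ⟨hM, hN0, hN | hN⟩ | ⟨hM, hN⟩ | ⟨hM, hN⟩
  · left; rw [hM]
    nlinarith [mul_le_mul_of_nonneg_left hN ha0]
  · right; rw [hM]
    nlinarith [mul_le_mul_of_nonneg_left hN ha0]
  · left; rw [hM]
    nlinarith [mul_le_mul_of_nonneg_left hN ha0]
  · right; rw [hM]
    nlinarith [mul_le_mul_of_nonneg_left hN ha0]
  · right; rw [hM]
    nlinarith [mul_le_mul_of_nonneg_left hN ha0]
  · right
    have h1 : 0 ≤ a ^ 2 * (N + MM / 3) := mul_nonneg ha0 hN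
    have h2 : 9 * (39 / 50 : ℝ) ^ 2 ≤ MM * h ^ 2 := by nlinarith [mul_le_mul_of_nonneg_left hh2 (by linarith : (0:ℝ) ≤ MM)]
    nlinarith

/-- **Dichotomy of fcc distances.** For `a ∈ [0.96, 0.99]`, `h ∈ [0.78, 0.81]`, two points of
`fccStacking a h` are at squared distance `≤ 199/100` or `≥ 137/50`: with `p = i − i'`, `q = j − j'`,
`m = k − k'` the squared distance is `a²(p² + pq + q² + pm + qm + m²/3) + m²h²`; `|m| ≥ 3` gives
`≥ 9h²`, `m = 0` gives `a²·{0, 1}` or `≥ 3a²`, `m = ±1` gives `a²/3 + h²`, `4a²/3 + h²` or `≥ 7a²/3 + h²`,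
`m = ±2` gives `≥ a²/3 + 4h² ≥ 2.7408`. [folklore] -/
theorem fcc_dist_sq_dichotomy {a h : ℝ} (ha : 24 / 25 ≤ a) (ha' : a ≤ 99 / 100) (hh : 39 / 50 ≤ h)
    (hh' : h ≤ 81 / 100) (k i j k' i' j' : ℤ) :
    dist (barlowPos a h constHagg k i j) (barlowPos a h constHagg k' i' j') ^ 2 ≤ 199 / 100 ∨
    137 / 50 ≤ dist (barlowPos a h constHagg k i j) (barlowPos a h constHagg k' i' j') ^ 2 := by
  rw [dist_barlowPos_sq]
  simp only [haggLabel_const]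
  have h3 : (Real.sqrt 3) ^ 2 = 3 := Real.sq_sqrt (by norm_num)
  -- name the integer differences
  obtain ⟨p, hp⟩ : ∃ p : ℤ, ((i : ℝ) - i') = p := ⟨i - i', by push_cast; ring⟩
  obtain ⟨q, hq⟩ : ∃ q : ℤ, ((j : ℝ) - j') = q := ⟨j - j', by push_cast; ring⟩
  obtain ⟨m, hm⟩ : ∃ m : ℤ, ((k : ℝ) - k') = m := ⟨k - k', by push_cast; ring⟩
  rw [hp, hq, hm]
  have key : (a * ((p : ℝ) + (q : ℝ) / 2 + (m : ℝ) / 2)) ^ 2 +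
      (a * Real.sqrt 3 / 2 * ((q : ℝ) + (m : ℝ) / 3)) ^ 2 + ((m : ℝ) * h) ^ 2 =
      a ^ 2 * (((p : ℝ) * p + p * q + q * q + p * m + q * m) + ((m : ℝ) * m) / 3) +
        ((m : ℝ) * m) * h ^ 2 := by
    linear_combination (a ^ 2 * ((q : ℝ) + (m : ℝ) / 3) ^ 2 / 4) * h3
  rw [key]
  have ha2 : (24 / 25 : ℝ) ^ 2 ≤ a ^ 2 := pow_le_pow_left₀ (by norm_num) ha 2
  have ha2' : a ^ 2 ≤ (99 / 100 : ℝ) ^ 2 := pow_le_pow_left₀ (by linarith) ha' 2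
  have hh2 : (39 / 50 : ℝ) ^ 2 ≤ h ^ 2 := pow_le_pow_left₀ (by norm_num) hh 2
  have hh2' : h ^ 2 ≤ (81 / 100 : ℝ) ^ 2 := pow_le_pow_left₀ (by linarith) hh' 2
  refine dichotomy_core ha2 ha2' hh2 hh2' ?_
  -- the integer side conditions
  rcases le_or_gt 3 |m| with hm3 | hm3
  · -- |m| ≥ 3
    refine Or.inr (Or.inr (Or.inr ⟨?_, ?_⟩))
    · have : (9 : ℤ) ≤ m * m := by
        rcases abs_cases m with ⟨habs, _⟩ | ⟨habs, _⟩ <;> nlinarith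
      exact_mod_cast this
    · have hFid : (p : ℝ) * p + p * q + q * q + p * m + q * m + (m : ℝ) * m / 3 =
          ((p : ℝ) + q / 2 + m / 2) ^ 2 + 3 / 4 * ((q : ℝ) + m / 3) ^ 2 := by ring
      rw [hFid]; positivity
  · have hmcases : m = 0 ∨ m = 1 ∨ m = -1 ∨ m = 2 ∨ m = -2 := by
      rcases abs_cases m with ⟨habs, _⟩ | ⟨habs, _⟩ <;> omega
    rcases hmcases with h0 | h1 | h1' | h2 | h2'
    · -- m = 0
      subst h0
      refine Or.inl ⟨by norm_num, ?_, ?_⟩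
      · have h0' : (0 : ℤ) ≤ p * p + p * q + q * q := by nlinarith [sq_nonneg (2 * p + q), sq_nonneg q]
        have : (0 : ℝ) ≤ (p : ℝ) * p + p * q + q * q := by exact_mod_cast h0'
        push_cast; linarith
      · rcases int_quad_le_one_or_three_le p q with hle | hge
        · left
          have : (p : ℝ) * p + p * q + q * q ≤ 1 := by exact_mod_cast hle
          push_cast; linarith
        · right
          have : (3 : ℝ) ≤ (p : ℝ) * p + p * q + q * q := by exact_mod_cast hge
          push_cast; linarith
    · -- m = 1
      subst h1
      refine Or.inr (Or.inl ⟨by norm_num, ?_, ?_⟩)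
      · have : (0 : ℝ) ≤ (p : ℝ) * p + p * q + q * q + p + q := by exact_mod_cast int_quad_nonneg₁ p q
        push_cast; linarith
      · rcases le_or_gt (p * p + p * q + q * q + p + q) 1 with hle | hge
        · left
          have : (p : ℝ) * p + p * q + q * q + p + q ≤ 1 := by exact_mod_cast hle
          push_cast; linarith
        · right
          have : (2 : ℝ) ≤ (p : ℝ) * p + p * q + q * q + p + q := by exact_mod_cast hge
          push_cast; linarith
    · -- m = -1
      subst h1'
      refine Or.inr (Or.inl ⟨by norm_num, ?_, ?_⟩)
      · have : (0 : ℝ) ≤ (p : ℝ) * p + p * q + q * q - p - q := by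
          exact_mod_cast int_quad_nonneg_sub₁ p q
        push_cast; linarith
      · rcases le_or_gt (p * p + p * q + q * q - p - q) 1 with hle | hge
        · left
          have : (p : ℝ) * p + p * q + q * q - p - q ≤ 1 := by exact_mod_cast hle
          push_cast; linarith
        · right
          have : (2 : ℝ) ≤ (p : ℝ) * p + p * q + q * q - p - q := by exact_mod_cast hge
          push_cast; linarith
    · -- m = 2
      subst h2
      refine Or.inr (Or.inr (Or.inl ⟨by norm_num, ?_⟩))
      have : (0 : ℝ) ≤ (p : ℝ) * p + p * q + q * q + 2 * p + 2 * q + 1 := by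
        exact_mod_cast int_quad_nonneg₂ p q
      push_cast; linarith
    · -- m = -2
      subst h2'
      refine Or.inr (Or.inr (Or.inl ⟨by norm_num, ?_⟩))
      have : (0 : ℝ) ≤ (p : ℝ) * p + p * q + q * q - 2 * p - 2 * q + 1 := by
        exact_mod_cast int_quad_nonneg_sub₂ p q
      push_cast; linarith

/-! ### The obstruction: no subset of a moved relaxed fcc stacking has a fine ball -/

/-- `‖2√(2/3)e₃‖² = 8/3`. [folklore] -/
theorem norm_layerPeriod_sq : ‖(layerNormal (2 * Real.sqrt (2 / 3)) : E3)‖ ^ 2 = 8 / 3 := by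
  have h := lam_norm_sq 0 0 1
  simpa using h

/-- **The fcc obstruction (local form).** If the part of `X` in the closed ball `B_ρ(c)`, `ρ ≥ 3`, is
contained in an isometric image of `fccStacking a h` with `a ∈ [0.96, 0.99]`, `h ∈ [0.78, 0.81]`, then NO
admissible datum two-way `ε`-matches `X` on `B_ρ(c)` for `ε ≤ 1/100` — whatever the sublattice offsets
`t`: the sites `t 0 + A z` (within `11/10` of `c`) and `t 0 + A (z + 2√(2/3)e₃)` lie in the ball and own
two points of `X ∩ B_ρ(c)` whose distance is within `2ε` of `‖A(2√(2/3)e₃)‖ ∈ [1.5431, 1.6249]`, hence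
has square in `(1.99, 2.74)` — excluded by `fcc_dist_sq_dichotomy`. [folklore] -/
theorem not_near_of_locally_fcc {a h : ℝ} (ha : 24 / 25 ≤ a) (ha' : a ≤ 99 / 100) (hh : 39 / 50 ≤ h)
    (hh' : h ≤ 81 / 100) {X : Set E3} {f : E3 → E3} (hf : Isometry f) {c : E3} {ρ : ℝ} (hρ : 3 ≤ ρ)
    (hX : ∀ p ∈ X, dist p c ≤ ρ → p ∈ f '' fccStacking a h) {t : Fin 2 → E3} {A : E3 →L[ℝ] E3}
    (hA : Adm A) {ε : ℝ} (hε : ε ≤ 1 / 100) : ¬ Near X c ρ t A ε := by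
  intro hN
  set ℓ : E3 := layerNormal (2 * Real.sqrt (2 / 3)) with hℓ
  have hℓmem : ℓ ∈ Lam := ⟨0, 0, 1, by simp [hℓ]⟩
  have hℓsq : ‖ℓ‖ ^ 2 = 8 / 3 := norm_layerPeriod_sq
  have hℓle : ‖ℓ‖ ≤ 1633 / 1000 := by nlinarith [norm_nonneg ℓ]
  have hℓge : 163299 / 100000 ≤ ‖ℓ‖ := by nlinarith [norm_nonneg ℓ]
  have hLle : ‖A ℓ‖ ≤ 199 / 200 * (1633 / 1000) := by
    have := adm_norm_le hA ℓ
    linarith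
  have hLge : 189 / 200 * (163299 / 100000) ≤ ‖A ℓ‖ := by
    have := adm_le_norm hA ℓ
    linarith
  -- the two sites
  obtain ⟨z, hz, hzc⟩ := exists_site_near hA (t 0) c
  have hzℓ : z + ℓ ∈ Lam := lam_add_mem hz hℓmem
  have hd : dist (t 0 + A (z + ℓ)) (t 0 + A z) = ‖A ℓ‖ := by
    rw [dist_site_site]; congr 1; abel_nf
  have hzℓc : dist (t 0 + A (z + ℓ)) c ≤ 2725 / 1000 := by
    calc dist (t 0 + A (z + ℓ)) c ≤ dist (t 0 + A (z + ℓ)) (t 0 + A z) + dist (t 0 + A z) c :=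
          dist_triangle _ _ _
      _ ≤ 199 / 200 * (1633 / 1000) + 11 / 10 := by rw [hd]; linarith
      _ ≤ 2725 / 1000 := by norm_num
  obtain ⟨p0, hp0, hp0d⟩ := hN.2 0 z hz (by linarith)
  obtain ⟨p3, hp3, hp3d⟩ := hN.2 0 (z + ℓ) hzℓ (by linarith)
  have hε0 : 0 ≤ ε := le_trans dist_nonneg hp0d
  -- both owned points lie in the ball, hence are images of fcc points
  have hp0c : dist p0 c ≤ ρ := by
    calc dist p0 c ≤ dist p0 (t 0 + A z) + dist (t 0 + A z) c := dist_triangle _ _ _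
      _ ≤ ε + 11 / 10 := by gcongr
      _ ≤ ρ := by linarith
  have hp3c : dist p3 c ≤ ρ := by
    calc dist p3 c ≤ dist p3 (t 0 + A (z + ℓ)) + dist (t 0 + A (z + ℓ)) c := dist_triangle _ _ _
      _ ≤ ε + 2725 / 1000 := by gcongr
      _ ≤ ρ := by linarith
  obtain ⟨y0, hy0, rfl⟩ := hX p0 hp0 hp0c
  obtain ⟨y3, hy3, rfl⟩ := hX p3 hp3 hp3c
  have hy0' : ∃ k i j : ℤ, y0 = barlowPos a h constHagg k i j := hy0
  have hy3' : ∃ k i j : ℤ, y3 = barlowPos a h constHagg k i j := hy3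
  obtain ⟨k, i, j, rfl⟩ := hy0'
  obtain ⟨k', i', j', rfl⟩ := hy3'
  have hD := hf.dist_eq (barlowPos a h constHagg k i j) (barlowPos a h constHagg k' i' j')
  -- |D - L| ≤ 2ε by two triangle inequalities
  have hup : dist (f (barlowPos a h constHagg k i j)) (f (barlowPos a h constHagg k' i' j')) ≤
      ε + ‖A ℓ‖ + ε := by
    calc _ ≤ dist (f (barlowPos a h constHagg k i j)) (t 0 + A z) + dist (t 0 + A z) (t 0 + A (z + ℓ))
          + dist (t 0 + A (z + ℓ)) (f (barlowPos a h constHagg k' i' j')) := dist_triangle4 _ _ _ _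
      _ ≤ ε + ‖A ℓ‖ + ε := by
        gcongr
        · rw [dist_comm, hd]
        · rw [dist_comm]; exact hp3d
  have hlow : ‖A ℓ‖ ≤ ε + dist (f (barlowPos a h constHagg k i j)) (f (barlowPos a h constHagg k' i' j'))
      + ε := by
    calc ‖A ℓ‖ = dist (t 0 + A z) (t 0 + A (z + ℓ)) := by rw [dist_comm, hd]
      _ ≤ dist (t 0 + A z) (f (barlowPos a h constHagg k i j)) +
          dist (f (barlowPos a h constHagg k i j)) (f (barlowPos a h constHagg k' i' j')) +
          dist (f (barlowPos a h constHagg k' i' j')) (t 0 + A (z + ℓ)) := dist_triangle4 _ _ _ _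
      _ ≤ ε + dist (f (barlowPos a h constHagg k i j)) (f (barlowPos a h constHagg k' i' j')) + ε := by
        gcongr
        · rw [dist_comm]; exact hp0d
  rw [hD] at hup hlow
  have hD0 : 0 ≤ dist (barlowPos a h constHagg k i j) (barlowPos a h constHagg k' i' j') := dist_nonneg
  rcases fcc_dist_sq_dichotomy ha ha' hh hh' k i j k' i' j' with hsmall | hbig
  · have h1 : (1523 / 1000 : ℝ) ≤ dist (barlowPos a h constHagg k i j) (barlowPos a h constHagg k' i' j') := by
      linarith
    nlinarith
  · have h1 : dist (barlowPos a h constHagg k i j) (barlowPos a h constHagg k' i' j') ≤ 1645 / 1000 := by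
      linarith
    nlinarith

/-- **The fcc obstruction (global form).** A subset of an isometric image of `fccStacking a h`
(`a ∈ [0.96, 0.99]`, `h ∈ [0.78, 0.81]`; finite, infinite or empty) has no two-way `ε`-matched
admissible ball of radius `ρ ≥ 3` for `ε ≤ 1/100`. [folklore] -/
theorem not_near_of_subset_fcc {a h : ℝ} (ha : 24 / 25 ≤ a) (ha' : a ≤ 99 / 100) (hh : 39 / 50 ≤ h)
    (hh' : h ≤ 81 / 100) {X : Set E3} {f : E3 → E3} (hf : Isometry f)
    (hX : X ⊆ f '' fccStacking a h) {c : E3} {t : Fin 2 → E3} {A : E3 →L[ℝ] E3} (hA : Adm A)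
    {ρ ε : ℝ} (hρ : 3 ≤ ρ) (hε : ε ≤ 1 / 100) : ¬ Near X c ρ t A ε :=
  not_near_of_locally_fcc ha ha' hh hh' hf hρ (fun _ hp _ => hX hp) hA hε

/-- **The matrix of `FineGrains` fails on every fcc piece:** a configuration whose particles lie in an
isometric image of `fccStacking a h` (`a ∈ [0.96, 0.99]`, `h ∈ [0.78, 0.81]`) has no fine ball of radius
`ρ ≥ 3` at tolerance `ε ≤ 1/100`, for any `N`.  So `FineGrains` is false as soon as, for infinitely many
`N`, some Lennard-Jones ground state is such a piece (the route's kill criterion; believed not to be the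
case: the static lattice sums favour hcp). [folklore] -/
theorem fineGrains_matrix_fails_on_fcc {a h : ℝ} (ha : 24 / 25 ≤ a) (ha' : a ≤ 99 / 100)
    (hh : 39 / 50 ≤ h) (hh' : h ≤ 81 / 100) {N : ℕ} {x : Fin N → E3} {f : E3 → E3} (hf : Isometry f)
    (hx : Set.range x ⊆ f '' fccStacking a h) {ρ ε : ℝ} (hρ : 3 ≤ ρ) (hε : ε ≤ 1 / 100) :
    ¬ ∃ (c : E3) (t : Fin 2 → E3) (A : E3 →L[ℝ] E3), Adm A ∧ Near (Set.range x) c ρ t A ε := by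
  rintro ⟨c, t, A, hA, hN⟩
  exact not_near_of_subset_fcc ha ha' hh hh' hf hx hA hρ hε hN


/-- **Kill criterion, formal:** "for infinitely many `N` some Lennard-Jones ground state is a piece of a
(moved, relaxed) fcc stacking with cell in the box `[0.96, 0.99] × [0.78, 0.81]`". Believed false
(hcp is favoured); recorded only to make `FineGrains`'s hcp-specificity precise. -/
def FccPieceGroundStates : Prop :=
  ∀ N₀ : ℕ, ∃ N : ℕ, N₀ ≤ N ∧ ∃ x : Fin N → E3, IsGroundState lennardJones x ∧
    ∃ (a h : ℝ) (f : E3 → E3), 24 / 25 ≤ a ∧ a ≤ 99 / 100 ∧ 39 / 50 ≤ h ∧ h ≤ 81 / 100 ∧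
      Isometry f ∧ Set.range x ⊆ f '' fccStacking a h

/-- **`FineGrains` is false on fcc-grained ground states** (at `(ρ, ε) = (3, 1/100)`). [folklore] -/
theorem fineGrains_false_of_fccPieces (hfcc : FccPieceGroundStates) :
    ¬ Theses.ExcessDecayLiouville.FineGrains := by
  intro h
  rw [fineGrains_iff] at h
  obtain ⟨N₀, hN₀⟩ := h 3 (1 / 100) (by norm_num) (by norm_num)
  obtain ⟨N, hN, x, hx, a, hh, f, ha, ha', hh1, hh2, hf, hsub⟩ := hfcc N₀
  exact fineGrains_matrix_fails_on_fcc ha ha' hh1 hh2 hf hsub (le_refl (3 : ℝ)) (le_refl (1 / 100 : ℝ))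
    (hN₀ N hN x hx)

/-! ### Coarse tolerance `1/40` near the relaxed cell (serves `CoarseGrains` / `CoarseGrainsWithoutInner`)

At the single tolerance `1/40` of the sibling crux `CoarseGrains` the same c-period argument still
works for fcc cells within `±0.4 %` of the relaxed Lennard-Jones fcc cell (`a ∈ [0.968, 0.975]`,
`h ∈ [0.790, 0.796]`; relaxed: `a ≈ 0.9712`, `h ≈ 0.7930`), with margins of a few `10⁻³`. -/

/-- Real core, relaxed box: `D² ≤ 1.91 ∨ D² ≥ 2.808`. [folklore] -/
theorem dichotomy_core_relaxed {a h N MM : ℝ} (ha2 : (121 / 125 : ℝ) ^ 2 ≤ a ^ 2)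
    (ha2' : a ^ 2 ≤ (39 / 40) ^ 2) (hh2 : (79 / 100 : ℝ) ^ 2 ≤ h ^ 2) (hh2' : h ^ 2 ≤ (199 / 250) ^ 2)
    (hcase : (MM = 0 ∧ 0 ≤ N ∧ (N ≤ 1 ∨ 3 ≤ N)) ∨ (MM = 1 ∧ 0 ≤ N ∧ (N ≤ 1 ∨ 2 ≤ N)) ∨
      (MM = 4 ∧ -1 ≤ N) ∨ (9 ≤ MM ∧ 0 ≤ N + MM / 3)) :
    a ^ 2 * (N + MM / 3) + MM * h ^ 2 ≤ 191 / 100 ∨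
      2808 / 1000 ≤ a ^ 2 * (N + MM / 3) + MM * h ^ 2 := by
  have ha0 : 0 ≤ a ^ 2 := sq_nonneg a
  have hh0 : 0 ≤ h ^ 2 := sq_nonneg h
  rcases hcase with ⟨hM, hN0, hN | hN⟩ | ⟨hM, hN0, hN | hN⟩ | ⟨hM, hN⟩ | ⟨hM, hN⟩
  · left; rw [hM]
    nlinarith [mul_le_mul_of_nonneg_left hN ha0]
  · right; rw [hM]
    nlinarith [mul_le_mul_of_nonneg_left hN ha0]
  · left; rw [hM]
    nlinarith [mul_le_mul_of_nonneg_left hN ha0]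
  · right; rw [hM]
    nlinarith [mul_le_mul_of_nonneg_left hN ha0]
  · right; rw [hM]
    nlinarith [mul_le_mul_of_nonneg_left hN ha0]
  · right
    have h1 : 0 ≤ a ^ 2 * (N + MM / 3) := mul_nonneg ha0 hN
    have h2 : 9 * (79 / 100 : ℝ) ^ 2 ≤ MM * h ^ 2 := by
      nlinarith [mul_le_mul_of_nonneg_left hh2 (by linarith : (0:ℝ) ≤ MM)]
    nlinarith

/-- Dichotomy of fcc distances, relaxed box: `D² ≤ 1.91 ∨ D² ≥ 2.808`. [folklore] -/
theorem fcc_dist_sq_dichotomy_relaxed {a h : ℝ} (ha : 121 / 125 ≤ a) (ha' : a ≤ 39 / 40)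
    (hh : 79 / 100 ≤ h) (hh' : h ≤ 199 / 250) (k i j k' i' j' : ℤ) :
    dist (barlowPos a h constHagg k i j) (barlowPos a h constHagg k' i' j') ^ 2 ≤ 191 / 100 ∨
    2808 / 1000 ≤ dist (barlowPos a h constHagg k i j) (barlowPos a h constHagg k' i' j') ^ 2 := by
  rw [dist_barlowPos_sq]
  simp only [haggLabel_const]
  have h3 : (Real.sqrt 3) ^ 2 = 3 := Real.sq_sqrt (by norm_num)
  obtain ⟨p, hp⟩ : ∃ p : ℤ, ((i : ℝ) - i') = p := ⟨i - i', by push_cast; ring⟩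
  obtain ⟨q, hq⟩ : ∃ q : ℤ, ((j : ℝ) - j') = q := ⟨j - j', by push_cast; ring⟩
  obtain ⟨m, hm⟩ : ∃ m : ℤ, ((k : ℝ) - k') = m := ⟨k - k', by push_cast; ring⟩
  rw [hp, hq, hm]
  have key : (a * ((p : ℝ) + (q : ℝ) / 2 + (m : ℝ) / 2)) ^ 2 +
      (a * Real.sqrt 3 / 2 * ((q : ℝ) + (m : ℝ) / 3)) ^ 2 + ((m : ℝ) * h) ^ 2 =
      a ^ 2 * (((p : ℝ) * p + p * q + q * q + p * m + q * m) + ((m : ℝ) * m) / 3) +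
        ((m : ℝ) * m) * h ^ 2 := by
    linear_combination (a ^ 2 * ((q : ℝ) + (m : ℝ) / 3) ^ 2 / 4) * h3
  rw [key]
  have ha2 : (121 / 125 : ℝ) ^ 2 ≤ a ^ 2 := pow_le_pow_left₀ (by norm_num) ha 2
  have ha2' : a ^ 2 ≤ (39 / 40 : ℝ) ^ 2 := pow_le_pow_left₀ (by linarith) ha' 2
  have hh2 : (79 / 100 : ℝ) ^ 2 ≤ h ^ 2 := pow_le_pow_left₀ (by norm_num) hh 2
  have hh2' : h ^ 2 ≤ (199 / 250 : ℝ) ^ 2 := pow_le_pow_left₀ (by linarith) hh' 2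
  refine dichotomy_core_relaxed ha2 ha2' hh2 hh2' ?_
  rcases le_or_gt 3 |m| with hm3 | hm3
  · refine Or.inr (Or.inr (Or.inr ⟨?_, ?_⟩))
    · have : (9 : ℤ) ≤ m * m := by
        rcases abs_cases m with ⟨habs, _⟩ | ⟨habs, _⟩ <;> nlinarith
      exact_mod_cast this
    · have hFid : (p : ℝ) * p + p * q + q * q + p * m + q * m + (m : ℝ) * m / 3 =
          ((p : ℝ) + q / 2 + m / 2) ^ 2 + 3 / 4 * ((q : ℝ) + m / 3) ^ 2 := by ring
      rw [hFid]; positivity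
  · have hmcases : m = 0 ∨ m = 1 ∨ m = -1 ∨ m = 2 ∨ m = -2 := by
      rcases abs_cases m with ⟨habs, _⟩ | ⟨habs, _⟩ <;> omega
    rcases hmcases with h0 | h1 | h1' | h2 | h2'
    · subst h0
      refine Or.inl ⟨by norm_num, ?_, ?_⟩
      · have h0' : (0 : ℤ) ≤ p * p + p * q + q * q := by nlinarith [sq_nonneg (2 * p + q), sq_nonneg q]
        have : (0 : ℝ) ≤ (p : ℝ) * p + p * q + q * q := by exact_mod_cast h0'
        push_cast; linarith
      · rcases int_quad_le_one_or_three_le p q with hle | hge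
        · left
          have : (p : ℝ) * p + p * q + q * q ≤ 1 := by exact_mod_cast hle
          push_cast; linarith
        · right
          have : (3 : ℝ) ≤ (p : ℝ) * p + p * q + q * q := by exact_mod_cast hge
          push_cast; linarith
    · subst h1
      refine Or.inr (Or.inl ⟨by norm_num, ?_, ?_⟩)
      · have : (0 : ℝ) ≤ (p : ℝ) * p + p * q + q * q + p + q := by exact_mod_cast int_quad_nonneg₁ p q
        push_cast; linarith
      · rcases le_or_gt (p * p + p * q + q * q + p + q) 1 with hle | hge
        · left
          have : (p : ℝ) * p + p * q + q * q + p + q ≤ 1 := by exact_mod_cast hle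
          push_cast; linarith
        · right
          have : (2 : ℝ) ≤ (p : ℝ) * p + p * q + q * q + p + q := by exact_mod_cast hge
          push_cast; linarith
    · subst h1'
      refine Or.inr (Or.inl ⟨by norm_num, ?_, ?_⟩)
      · have : (0 : ℝ) ≤ (p : ℝ) * p + p * q + q * q - p - q := by
          exact_mod_cast int_quad_nonneg_sub₁ p q
        push_cast; linarith
      · rcases le_or_gt (p * p + p * q + q * q - p - q) 1 with hle | hge
        · left
          have : (p : ℝ) * p + p * q + q * q - p - q ≤ 1 := by exact_mod_cast hle
          push_cast; linarith
        · right
          have : (2 : ℝ) ≤ (p : ℝ) * p + p * q + q * q - p - q := by exact_mod_cast hge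
          push_cast; linarith
    · subst h2
      refine Or.inr (Or.inr (Or.inl ⟨by norm_num, ?_⟩))
      have : (0 : ℝ) ≤ (p : ℝ) * p + p * q + q * q + 2 * p + 2 * q + 1 := by
        exact_mod_cast int_quad_nonneg₂ p q
      push_cast; linarith
    · subst h2'
      refine Or.inr (Or.inr (Or.inl ⟨by norm_num, ?_⟩))
      have : (0 : ℝ) ≤ (p : ℝ) * p + p * q + q * q - 2 * p - 2 * q + 1 := by
        exact_mod_cast int_quad_nonneg_sub₂ p q
      push_cast; linarith

/-- **The fcc obstruction at the coarse tolerance `1/40`** (local form, relaxed box): if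
`X ∩ B_ρ(c)` (`ρ ≥ 3`) lies in an isometric image of `fccStacking a h` with `a ∈ [0.968, 0.975]`,
`h ∈ [0.790, 0.796]`, then no admissible datum — whatever the offsets `t` — two-way `ε`-matches `X` on
`B_ρ(c)` for `ε ≤ 1/40`.  In particular the matrix of `CoarseGrains` (with or without `Inner`) fails on
near-relaxed fcc pieces. [folklore] -/
theorem not_near_of_locally_fcc_coarse {a h : ℝ} (ha : 121 / 125 ≤ a) (ha' : a ≤ 39 / 40)
    (hh : 79 / 100 ≤ h) (hh' : h ≤ 199 / 250) {X : Set E3} {f : E3 → E3} (hf : Isometry f) {c : E3}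
    {ρ : ℝ} (hρ : 3 ≤ ρ) (hX : ∀ p ∈ X, dist p c ≤ ρ → p ∈ f '' fccStacking a h) {t : Fin 2 → E3}
    {A : E3 →L[ℝ] E3} (hA : Adm A) {ε : ℝ} (hε : ε ≤ 1 / 40) : ¬ Near X c ρ t A ε := by
  intro hN
  set ℓ : E3 := layerNormal (2 * Real.sqrt (2 / 3)) with hℓ
  have hℓmem : ℓ ∈ Lam := ⟨0, 0, 1, by simp [hℓ]⟩
  have hℓsq : ‖ℓ‖ ^ 2 = 8 / 3 := norm_layerPeriod_sq
  have hℓle : ‖ℓ‖ ≤ 1633 / 1000 := by nlinarith [norm_nonneg ℓ]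
  have hℓge : 163299 / 100000 ≤ ‖ℓ‖ := by nlinarith [norm_nonneg ℓ]
  have hLle : ‖A ℓ‖ ≤ 199 / 200 * (1633 / 1000) := by
    have := adm_norm_le hA ℓ
    linarith
  have hLge : 189 / 200 * (163299 / 100000) ≤ ‖A ℓ‖ := by
    have := adm_le_norm hA ℓ
    linarith
  obtain ⟨z, hz, hzc⟩ := exists_site_near hA (t 0) c
  have hzℓ : z + ℓ ∈ Lam := lam_add_mem hz hℓmem
  have hd : dist (t 0 + A (z + ℓ)) (t 0 + A z) = ‖A ℓ‖ := by
    rw [dist_site_site]; congr 1; abel_nf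
  have hzℓc : dist (t 0 + A (z + ℓ)) c ≤ 2725 / 1000 := by
    calc dist (t 0 + A (z + ℓ)) c ≤ dist (t 0 + A (z + ℓ)) (t 0 + A z) + dist (t 0 + A z) c :=
          dist_triangle _ _ _
      _ ≤ 199 / 200 * (1633 / 1000) + 11 / 10 := by rw [hd]; linarith
      _ ≤ 2725 / 1000 := by norm_num
  obtain ⟨p0, hp0, hp0d⟩ := hN.2 0 z hz (by linarith)
  obtain ⟨p3, hp3, hp3d⟩ := hN.2 0 (z + ℓ) hzℓ (by linarith)
  have hε0 : 0 ≤ ε := le_trans dist_nonneg hp0d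
  have hp0c : dist p0 c ≤ ρ := by
    calc dist p0 c ≤ dist p0 (t 0 + A z) + dist (t 0 + A z) c := dist_triangle _ _ _
      _ ≤ ε + 11 / 10 := by gcongr
      _ ≤ ρ := by linarith
  have hp3c : dist p3 c ≤ ρ := by
    calc dist p3 c ≤ dist p3 (t 0 + A (z + ℓ)) + dist (t 0 + A (z + ℓ)) c := dist_triangle _ _ _
      _ ≤ ε + 2725 / 1000 := by gcongr
      _ ≤ ρ := by linarith
  obtain ⟨y0, hy0, rfl⟩ := hX p0 hp0 hp0c
  obtain ⟨y3, hy3, rfl⟩ := hX p3 hp3 hp3c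
  have hy0' : ∃ k i j : ℤ, y0 = barlowPos a h constHagg k i j := hy0
  have hy3' : ∃ k i j : ℤ, y3 = barlowPos a h constHagg k i j := hy3
  obtain ⟨k, i, j, rfl⟩ := hy0'
  obtain ⟨k', i', j', rfl⟩ := hy3'
  have hD := hf.dist_eq (barlowPos a h constHagg k i j) (barlowPos a h constHagg k' i' j')
  have hup : dist (f (barlowPos a h constHagg k i j)) (f (barlowPos a h constHagg k' i' j')) ≤
      ε + ‖A ℓ‖ + ε := by
    calc _ ≤ dist (f (barlowPos a h constHagg k i j)) (t 0 + A z) + dist (t 0 + A z) (t 0 + A (z + ℓ))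
          + dist (t 0 + A (z + ℓ)) (f (barlowPos a h constHagg k' i' j')) := dist_triangle4 _ _ _ _
      _ ≤ ε + ‖A ℓ‖ + ε := by
        gcongr
        · rw [dist_comm, hd]
        · rw [dist_comm]; exact hp3d
  have hlow : ‖A ℓ‖ ≤ ε + dist (f (barlowPos a h constHagg k i j)) (f (barlowPos a h constHagg k' i' j'))
      + ε := by
    calc ‖A ℓ‖ = dist (t 0 + A z) (t 0 + A (z + ℓ)) := by rw [dist_comm, hd]
      _ ≤ dist (t 0 + A z) (f (barlowPos a h constHagg k i j)) +
          dist (f (barlowPos a h constHagg k i j)) (f (barlowPos a h constHagg k' i' j')) +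
          dist (f (barlowPos a h constHagg k' i' j')) (t 0 + A (z + ℓ)) := dist_triangle4 _ _ _ _
      _ ≤ ε + dist (f (barlowPos a h constHagg k i j)) (f (barlowPos a h constHagg k' i' j')) + ε := by
        gcongr
        · rw [dist_comm]; exact hp0d
  rw [hD] at hup hlow
  have hD0 : 0 ≤ dist (barlowPos a h constHagg k i j) (barlowPos a h constHagg k' i' j') := dist_nonneg
  rcases fcc_dist_sq_dichotomy_relaxed ha ha' hh hh' k i j k' i' j' with hsmall | hbig
  · have h1 : (149 / 100 : ℝ) ≤ dist (barlowPos a h constHagg k i j) (barlowPos a h constHagg k' i' j') := by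
      linarith
    nlinarith
  · have h1 : dist (barlowPos a h constHagg k i j) (barlowPos a h constHagg k' i' j') ≤ 1675 / 1000 := by
      linarith
    nlinarith


/-! ## (h) The intended model — hcp pieces DO have fine balls (exactly); the matrix discriminates hcp from fcc

Interface check (refuter step 6(i)): the crux's matrix has its intended non-junk inhabitant.  For every
isotropic admissible cell `a·id`, `a ∈ [0.945, 0.995]`, the ideal-ratio hcp crystal `hcpStacking a (a√(2/3))`
is two-way matched at tolerance `0` on EVERY ball by the hcp datum (site set `=` the stacking, by the
sibling kit's `hcpLiouvilleSites_eq_hcpStacking`), and so is any configuration agreeing with it on the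
ball.  Together with (g): hcp-grained matter passes, fcc-grained matter fails — the crux asks exactly
for hcp grains, as intended (landed as `HcpModel`). -/

/-- Isotropic cells `a·id` with `a ∈ [0.945, 0.995]` are admissible (`‖a·id − 0.97·id‖ = |a − 0.97|`).
[folklore] -/
theorem adm_smul_id_of_mem {a : ℝ} (ha : 189 / 200 ≤ a) (ha' : a ≤ 199 / 200) :
    Adm (a • ContinuousLinearMap.id ℝ E3) := by
  refine ⟨LinearIsometryEquiv.refl ℝ E3, ?_⟩
  have h0 : a • ContinuousLinearMap.id ℝ E3 - (97 / 100 : ℝ) •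
      ((LinearIsometryEquiv.refl ℝ E3).toContinuousLinearEquiv : E3 →L[ℝ] E3) =
      (a - 97 / 100) • ContinuousLinearMap.id ℝ E3 := by
    ext w
    simp [sub_smul]
  rw [h0, norm_smul, ContinuousLinearMap.norm_id, Real.norm_eq_abs, mul_one]
  rw [abs_le]; constructor <;> linarith

/-- The hcp datum: `t = (0, a(w + √(2/3)e₃))`. -/
def hcpDatum (a : ℝ) : Fin 2 → E3 := ![0, a • (barlowOffset 1 + layerNormal (Real.sqrt (2 / 3)))]

/-- The site set of the hcp datum with the isotropic cell `a·id` is `hcpStacking a (a√(2/3))`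
(re-export of `hcpLiouvilleSites_eq_hcpStacking` over the named predicate `Lam`). [folklore] -/
theorem sites_hcpDatum_eq (a : ℝ) :
    {p : E3 | ∃ m : Fin 2, ∃ z ∈ Lam, p = hcpDatum a m + (a • ContinuousLinearMap.id ℝ E3) z}
      = hcpStacking a (a * Real.sqrt (2 / 3)) :=
  Summit.AtomisticToContinuum.Crystallization.Theorems.hcpLiouvilleSites_eq_hcpStacking a

/-- **A set that agrees with `hcpStacking a (a√(2/3))` on the closed ball `B_ρ(c)` is two-way matched
there at tolerance `0`** by the hcp datum with cell `a·id`. [folklore] -/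
theorem near_of_locally_hcp (a : ℝ) {X : Set E3} {c : E3} {ρ : ℝ}
    (h₁ : ∀ p ∈ X, dist p c ≤ ρ → p ∈ hcpStacking a (a * Real.sqrt (2 / 3)))
    (h₂ : ∀ p ∈ hcpStacking a (a * Real.sqrt (2 / 3)), dist p c ≤ ρ → p ∈ X) :
    Near X c ρ (hcpDatum a) (a • ContinuousLinearMap.id ℝ E3) 0 := by
  have hS := sites_hcpDatum_eq a
  refine ⟨fun p hp hpc => ?_, fun m z hz hzc => ?_⟩
  · have hp' : p ∈ hcpStacking a (a * Real.sqrt (2 / 3)) := h₁ p hp hpc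
    rw [← hS] at hp'
    obtain ⟨m, z, hz, rfl⟩ := hp'
    exact ⟨m, z, hz, by simp⟩
  · have hsite : hcpDatum a m + (a • ContinuousLinearMap.id ℝ E3) z ∈
        hcpStacking a (a * Real.sqrt (2 / 3)) := by
      rw [← hS]; exact ⟨m, z, hz, rfl⟩
    exact ⟨_, h₂ _ hsite hzc, by simp⟩

/-- **The intended model:** the ideal-ratio hcp crystal `hcpStacking a (a√(2/3))` is two-way matched at
tolerance `0` on every closed ball by the admissible hcp datum (`a ∈ [0.945, 0.995]` for admissibility,
`adm_smul_id_of_mem`). [folklore] -/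
theorem near_hcpStacking (a : ℝ) (c : E3) (ρ : ℝ) :
    Near (hcpStacking a (a * Real.sqrt (2 / 3))) c ρ (hcpDatum a) (a • ContinuousLinearMap.id ℝ E3) 0 :=
  near_of_locally_hcp a (fun _ hp _ => hp) (fun _ hp _ => hp)

/-- Hence the matrix of `FineGrains` holds, at EVERY tolerance `ε ≥ 0` and every radius, for any
configuration that coincides with an ideal-ratio hcp crystal (`a ∈ [0.945, 0.995]`) on some closed
`ρ`-ball (the relaxed LJ hcp cell has `c/a` off ideal by `1.4·10⁻⁴`, absorbed by an anisotropic `A`,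
not treated here) —
the crux's interface has its intended non-junk model (contrast `FccObstruction`). [folklore] -/
theorem fineGrains_matrix_of_locally_hcp {a : ℝ} (ha : 189 / 200 ≤ a) (ha' : a ≤ 199 / 200) {N : ℕ}
    {x : Fin N → E3} {c : E3} {ρ ε : ℝ} (hε : 0 ≤ ε)
    (h₁ : ∀ p ∈ Set.range x, dist p c ≤ ρ → p ∈ hcpStacking a (a * Real.sqrt (2 / 3)))
    (h₂ : ∀ p ∈ hcpStacking a (a * Real.sqrt (2 / 3)), dist p c ≤ ρ → p ∈ Set.range x) :
    ∃ (c' : E3) (t : Fin 2 → E3) (A : E3 →L[ℝ] E3), Adm A ∧ Near (Set.range x) c' ρ t A ε := by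
  refine ⟨c, hcpDatum a, a • ContinuousLinearMap.id ℝ E3, adm_smul_id_of_mem ha ha', ?_⟩
  have h0 := near_of_locally_hcp a h₁ h₂
  exact ⟨fun p hp hpc => by
      obtain ⟨m, z, hz, hd⟩ := h0.1 p hp hpc
      exact ⟨m, z, hz, hd.trans hε⟩,
    fun m z hz hzc => by
      obtain ⟨p, hp, hd⟩ := h0.2 m z hz hzc
      exact ⟨p, hp, hd.trans hε⟩⟩


/-! ## (h′) The RELAXED hcp crystal (non-ideal `c/a`) also passes: axially stretched admissible cells

The relaxed Lennard-Jones hcp cell has `c/a` off ideal by `≈ 1.4·10⁻⁴`; it is the site set of the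
axially stretched cell `a·id + δ·P₃` (`h = (a + δ)√(2/3)`), admissible once `|a − 0.97| + |δ| ≤ 1/40`
(`≈ 0.0014` for the relaxed cell) — so the affine window does absorb the relaxed `c/a`, as the route text
asserts (landed as `HcpModelRelaxed`). -/

/-- The axial projector `P₃ w = (w 2) e₃`. -/
def P3 : E3 →L[ℝ] E3 :=
  (EuclideanSpace.proj (2 : Fin 3) : E3 →L[ℝ] ℝ).smulRight (EuclideanSpace.single (2 : Fin 3) (1 : ℝ))

/-- `P₃ w = (w 2)·e₃`. [folklore] -/
theorem P3_apply (w : E3) : P3 w = (w 2) • EuclideanSpace.single (2 : Fin 3) (1 : ℝ) := by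
  simp [P3]

/-- Coordinates of `P₃ w`. [folklore] -/
theorem P3_coord (w : E3) (l : Fin 3) : (P3 w) l = if l = 2 then w 2 else 0 := by
  rw [P3_apply]
  fin_cases l <;> simp

/-- `‖P₃ w‖ ≤ ‖w‖`. [folklore] -/
theorem norm_P3_apply_le (w : E3) : ‖P3 w‖ ≤ ‖w‖ := by
  rw [P3_apply, norm_smul, PiLp.norm_single, norm_one, mul_one, Real.norm_eq_abs]
  exact abs_apply_le_norm w 2

/-- The axially stretched cell `A = a·id + δ·P₃` (principal stretches `a, a, a + δ`). -/
def cell (a δ : ℝ) : E3 →L[ℝ] E3 := a • ContinuousLinearMap.id ℝ E3 + δ • P3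

/-- First coordinate of `A w`: `a·w₀`. [folklore] -/
theorem cell_apply0 (a δ : ℝ) (w : E3) : (cell a δ w) 0 = a * w 0 := by
  simp [cell, P3_coord]

/-- Second coordinate of `A w`: `a·w₁`. [folklore] -/
theorem cell_apply1 (a δ : ℝ) (w : E3) : (cell a δ w) 1 = a * w 1 := by
  simp [cell, P3_coord]

/-- Third coordinate of `A w`: `(a + δ)·w₂`. [folklore] -/
theorem cell_apply2 (a δ : ℝ) (w : E3) : (cell a δ w) 2 = (a + δ) * w 2 := by
  simp [cell, P3_coord]; ring

/-- Axially stretched cells with `|a − 0.97| + |δ| ≤ 1/40` are admissible. [folklore] -/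
theorem adm_cell {a δ : ℝ} (h : |a - 97 / 100| + |δ| ≤ 1 / 40) : Adm (cell a δ) := by
  refine ⟨LinearIsometryEquiv.refl ℝ E3, ?_⟩
  have h0 : cell a δ - (97 / 100 : ℝ) •
      ((LinearIsometryEquiv.refl ℝ E3).toContinuousLinearEquiv : E3 →L[ℝ] E3) =
      (a - 97 / 100) • ContinuousLinearMap.id ℝ E3 + δ • P3 := by
    ext w
    simp [cell, sub_smul]
    abel
  rw [h0]
  refine ContinuousLinearMap.opNorm_le_bound _ (by positivity) fun w => ?_
  calc ‖((a - 97 / 100) • ContinuousLinearMap.id ℝ E3 + δ • P3) w‖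
        = ‖(a - 97 / 100) • w + δ • P3 w‖ := by simp
    _ ≤ ‖(a - 97 / 100) • w‖ + ‖δ • P3 w‖ := norm_add_le _ _
    _ = |a - 97 / 100| * ‖w‖ + |δ| * ‖P3 w‖ := by rw [norm_smul, norm_smul, Real.norm_eq_abs, Real.norm_eq_abs]
    _ ≤ |a - 97 / 100| * ‖w‖ + |δ| * ‖w‖ := by gcongr; exact norm_P3_apply_le w
    _ = (|a - 97 / 100| + |δ|) * ‖w‖ := by ring
    _ ≤ 1 / 40 * ‖w‖ := mul_le_mul_of_nonneg_right h (norm_nonneg w)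

/-- The relaxed-hcp datum for the cell `A`: `t = (0, A(w + √(2/3)e₃))`. -/
def relaxedDatum (a δ : ℝ) : Fin 2 → E3 :=
  ![0, cell a δ (barlowOffset 1 + layerNormal (Real.sqrt (2 / 3)))]

/-- **The site set of the axially stretched cell is the relaxed hcp stacking**
`hcpStacking a ((a + δ)√(2/3))` (in-plane spacing `a`, layer spacing `h = (a + δ)√(2/3)`). [folklore] -/
theorem sites_cell_eq (a δ : ℝ) :
    {p : E3 | ∃ m : Fin 2, ∃ z ∈ Lam, p = relaxedDatum a δ m + cell a δ z}
      = hcpStacking a ((a + δ) * Real.sqrt (2 / 3)) := by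
  ext p
  constructor
  · rintro ⟨m, z, ⟨i, j, k, rfl⟩, rfl⟩
    fin_cases m
    · refine ⟨2 * k, i, j, ?_⟩
      have hE : haggLabel alternatingHagg (2 * k) = 0 := by
        rw [haggLabel_alternating, if_pos (even_two_mul k)]
      ext l; fin_cases l
      · simp [relaxedDatum, barlowPos, triangularVec₁, triangularVec₂, barlowOffset, layerNormal, hE, cell_apply0]
        left; ring
      · simp [relaxedDatum, barlowPos, triangularVec₁, triangularVec₂, barlowOffset, layerNormal, hE, cell_apply1]
        left; ring
      · simp [relaxedDatum, barlowPos, triangularVec₁, triangularVec₂, barlowOffset, layerNormal, hE, cell_apply2]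
        ring
    · refine ⟨2 * k + 1, i, j, ?_⟩
      have hO : haggLabel alternatingHagg (2 * k + 1) = 1 := by
        rw [haggLabel_alternating, if_neg (Int.not_even_two_mul_add_one k)]
      ext l; fin_cases l
      · simp [relaxedDatum, barlowPos, triangularVec₁, triangularVec₂, barlowOffset, layerNormal, hO, cell_apply0]
        ring
      · simp [relaxedDatum, barlowPos, triangularVec₁, triangularVec₂, barlowOffset, layerNormal, hO, cell_apply1]
        ring
      · simp [relaxedDatum, barlowPos, triangularVec₁, triangularVec₂, barlowOffset, layerNormal, hO, cell_apply2]
        ring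
  · rintro ⟨K, i, j, rfl⟩
    rcases Int.even_or_odd' K with ⟨k, rfl | rfl⟩
    · refine ⟨0, _, ⟨i, j, k, rfl⟩, ?_⟩
      have hE : haggLabel alternatingHagg (2 * k) = 0 := by
        rw [haggLabel_alternating, if_pos (even_two_mul k)]
      ext l; fin_cases l
      · simp [relaxedDatum, barlowPos, triangularVec₁, triangularVec₂, barlowOffset, layerNormal, hE, cell_apply0]
        left; ring
      · simp [relaxedDatum, barlowPos, triangularVec₁, triangularVec₂, barlowOffset, layerNormal, hE, cell_apply1]
        left; ring
      · simp [relaxedDatum, barlowPos, triangularVec₁, triangularVec₂, barlowOffset, layerNormal, hE, cell_apply2]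
        ring
    · refine ⟨1, _, ⟨i, j, k, rfl⟩, ?_⟩
      have hO : haggLabel alternatingHagg (2 * k + 1) = 1 := by
        rw [haggLabel_alternating, if_neg (Int.not_even_two_mul_add_one k)]
      ext l; fin_cases l
      · simp [relaxedDatum, barlowPos, triangularVec₁, triangularVec₂, barlowOffset, layerNormal, hO, cell_apply0]
        ring
      · simp [relaxedDatum, barlowPos, triangularVec₁, triangularVec₂, barlowOffset, layerNormal, hO, cell_apply1]
        ring
      · simp [relaxedDatum, barlowPos, triangularVec₁, triangularVec₂, barlowOffset, layerNormal, hO, cell_apply2]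
        ring

/-- **A set that agrees with the relaxed hcp stacking `hcpStacking a ((a+δ)√(2/3))` on the closed
ball `B_ρ(c)` is two-way matched there at tolerance `0`** by the relaxed datum with cell `a·id + δ·P₃`.
[folklore] -/
theorem near_of_locally_relaxedHcp (a δ : ℝ) {X : Set E3} {c : E3} {ρ : ℝ}
    (h₁ : ∀ p ∈ X, dist p c ≤ ρ → p ∈ hcpStacking a ((a + δ) * Real.sqrt (2 / 3)))
    (h₂ : ∀ p ∈ hcpStacking a ((a + δ) * Real.sqrt (2 / 3)), dist p c ≤ ρ → p ∈ X) :
    Near X c ρ (relaxedDatum a δ) (cell a δ) 0 := by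
  have hS := sites_cell_eq a δ
  refine ⟨fun p hp hpc => ?_, fun m z hz hzc => ?_⟩
  · have hp' : p ∈ hcpStacking a ((a + δ) * Real.sqrt (2 / 3)) := h₁ p hp hpc
    rw [← hS] at hp'
    obtain ⟨m, z, hz, rfl⟩ := hp'
    exact ⟨m, z, hz, by simp⟩
  · have hsite : relaxedDatum a δ m + cell a δ z ∈ hcpStacking a ((a + δ) * Real.sqrt (2 / 3)) := by
      rw [← hS]; exact ⟨m, z, hz, rfl⟩
    exact ⟨_, h₂ _ hsite hzc, by simp⟩

/-- **The relaxed hcp crystal is two-way matched at tolerance `0` on every ball** by the relaxed datum.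
[folklore] -/
theorem near_relaxedHcpStacking (a δ : ℝ) (c : E3) (ρ : ℝ) :
    Near (hcpStacking a ((a + δ) * Real.sqrt (2 / 3))) c ρ (relaxedDatum a δ) (cell a δ) 0 :=
  near_of_locally_relaxedHcp a δ (fun _ hp _ => hp) (fun _ hp _ => hp)

/-- Hence the matrix of `FineGrains` holds, at every tolerance `ε ≥ 0` and every radius, for any
configuration that coincides on some closed `ρ`-ball with a relaxed hcp crystal `hcpStacking a h`,
`h = (a + δ)√(2/3)`, `|a − 0.97| + |δ| ≤ 1/40` (this covers the relaxed Lennard-Jones cell). [folklore] -/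
theorem fineGrains_matrix_of_locally_relaxedHcp {a δ : ℝ} (hA : |a - 97 / 100| + |δ| ≤ 1 / 40) {N : ℕ}
    {x : Fin N → E3} {c : E3} {ρ ε : ℝ} (hε : 0 ≤ ε)
    (h₁ : ∀ p ∈ Set.range x, dist p c ≤ ρ → p ∈ hcpStacking a ((a + δ) * Real.sqrt (2 / 3)))
    (h₂ : ∀ p ∈ hcpStacking a ((a + δ) * Real.sqrt (2 / 3)), dist p c ≤ ρ → p ∈ Set.range x) :
    ∃ (c' : E3) (t : Fin 2 → E3) (A : E3 →L[ℝ] E3), Adm A ∧ Near (Set.range x) c' ρ t A ε := by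
  refine ⟨c, relaxedDatum a δ, cell a δ, adm_cell hA, ?_⟩
  have h0 := near_of_locally_relaxedHcp a δ h₁ h₂
  exact ⟨fun p hp hpc => by
      obtain ⟨m, z, hz, hd⟩ := h0.1 p hp hpc
      exact ⟨m, z, hz, hd.trans hε⟩,
    fun m z hz hzc => by
      obtain ⟨p, hp, hd⟩ := h0.2 m z hz hzc
      exact ⟨p, hp, hd.trans hε⟩⟩


/-! ## (c′) Orientation inside the route: `FineGrains` versus `CoarseGrains`

`FineGrains` at `ε = 1/40` gives the sibling crux `CoarseGrains` (stmt-9331) WITHOUT its inner-displacement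
clause `Inner t A`.  The converse bookkeeping (`FineGrains → CoarseGrains`) is NOT pure logic: a fine datum
found at small `ε` may have `t 1 − t 0` in the hcp class `±A(w + √(2/3)e₃) + AΛ` (then a sublattice swap
and a lattice translate of `t 1` restore `Inner` with the same site set), but nothing in the statement
excludes a datum of another class (collapsed `t 0 = t 1`, or `t 1 − t 0 = A(u/2)`, …) two-way matching
some large ground state — excluding that needs the structure of ground states, i.e. the crux itself.
The route uses the other direction anyway (`GrainsGlue : PhononStability → HcpLiouville → CoarseGrains →
FineGrains`). -/

/-- `CoarseGrains` with its inner-displacement clause dropped. -/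
def CoarseGrainsWithoutInner : Prop :=
  ∀ R : ℝ, 0 < R → ∃ N₀ : ℕ, ∀ N : ℕ, N₀ ≤ N → ∀ x : Fin N → E3,
    IsGroundState lennardJones x →
    ∃ (c : E3) (t : Fin 2 → E3) (A : E3 →L[ℝ] E3), Adm A ∧ Near (Set.range x) c R t A (1 / 40)

/-- `FineGrains → CoarseGrains-without-Inner` (instantiate `ε := 1/40`). [folklore] -/
theorem coarseGrainsWithoutInner_of_fineGrains :
    Theses.ExcessDecayLiouville.FineGrains → CoarseGrainsWithoutInner := by
  intro h R hR
  rw [fineGrains_iff] at h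
  obtain ⟨N₀, hN₀⟩ := h R (1 / 40) hR (by norm_num)
  exact ⟨N₀, fun N hN x hx => hN₀ N hN x hx⟩

/-- `CoarseGrains → CoarseGrains-without-Inner` (forget the clause). [folklore] -/
theorem coarseGrainsWithoutInner_of_coarseGrains :
    Theses.ExcessDecayLiouville.CoarseGrains → CoarseGrainsWithoutInner := by
  intro h R hR
  rw [coarseGrains_iff] at h
  obtain ⟨N₀, hN₀⟩ := h R hR
  refine ⟨N₀, fun N hN x hx => ?_⟩
  obtain ⟨c, t, A, hA, -, hNear⟩ := hN₀ N hN x hx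
  exact ⟨c, t, A, hA, hNear⟩

/-- The load-bearing analysis transfers: `CoarseGrains-without-Inner` minus minimality / largeness is
refuted by the same witnesses (its matrix at `R` is `HasFineBall R (1/40)`); recorded as the statement
that any `N₀(R)` valid for it is `≥ ((R − 11/10)/4)³`. [folklore] -/
theorem coarseGrainsWithoutInner_threshold_cubic {R : ℝ} {N₀ : ℕ}
    (h : ∀ N : ℕ, N₀ ≤ N → ∀ x : Fin N → E3, IsGroundState lennardJones x →
      ∃ (c : E3) (t : Fin 2 → E3) (A : E3 →L[ℝ] E3), Adm A ∧ Near (Set.range x) c R t A (1 / 40))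
    (K : ℕ) (hR : 11 / 10 + 4 * K ≤ R) : (K + 1) ^ 3 ≤ N₀ :=
  threshold_cubic (le_refl (1 / 40 : ℝ)) (fun N hN x hx => h N hN x hx) K hR

/-! ## (d) Targets — none handed over (payload `targets = []`, `stuck_stubs = []`; no line picked yet for
this crux).  (e) Near-misses — none: no candidate kill of the crux is believed true by this seat (see
"WHY THE CRUX RESISTS" in the module docblock). -/

/-- Probe: the crux elaborates; this restatement is what a kill would have to negate —
`¬FineGrains ↔ ∃ ρ ε > 0, ∀ N₀, ∃ N ≥ N₀, ∃ ground state x : Fin N → ℝ³, ¬HasFineBall ρ ε x`. [folklore] -/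
theorem not_fineGrains_iff :
    ¬ Theses.ExcessDecayLiouville.FineGrains ↔
    ∃ ρ ε : ℝ, 0 < ρ ∧ 0 < ε ∧ ∀ N₀ : ℕ, ∃ N : ℕ, N₀ ≤ N ∧ ∃ x : Fin N → E3,
      IsGroundState lennardJones x ∧ ¬ HasFineBall ρ ε x := by
  rw [fineGrains_iff]
  push Not
  rfl

end Summit.AtomisticToContinuum.Crystallization.Cruxes.FineGrains.Disproof

end
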